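import Mathlib
import HarnessLib
import HarnessLib.Audit
import Summits.FinalStateConjecture.Statement
import Literature.Geometry.Lorentzian.LandauLifshitzPseudotensor
import HarnessLib.Audit.Status.Attr

/-!
Route: RecedingSphereBudgets

DORMANT since 2026-08-23T07:21:34Z (reconciler: no traction for 6 d (last activity statement-checked at 2026-08-17T07:23:38Z); parked, not closed — `ledger route dormant route-FinalStateConjecture-RecedingSphereBudgets --off` to reactiv) — unstaffed, not closed; items shared with open routes are served there. `ledger route dormant <id> --off` reactivates.

# Route RecedingSphereBudgets — every hole has its own Bondi mass — receding-sphere energy and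
torque budgets freeze the drifting Kerr labels of a shape-settled final era

It suffices to show X = H ∧ M ∧ S ∧ R — four cruxes, exactly the hypotheses of the deciding theorem
`closes` (R was re-badged support → crux on 2026-08-16 under the crux-only rule: it is an unproved,
load-bearing hypothesis of `closes`) — realising card every-hole-has-its-own-bondi-mass (sole card).
The seam is a SHAPE-SETTLED FINAL ERA WITH DRIFTING LABELS Q(𝒟): N hole charts on collar domains {r
> r₊(M(t*),a(t*)) − δ₀} of
boosted Kerr–Schild coordinates with FIXED motions (Λᵢ, cᵢ) (future-directed, pairwise distinct
4-velocities = hyperbolic final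
motions) in which the C^k deviation (every k; rev 14) from the ADIABATIC Kerr–Schild background with
labels (Mᵢ(τ), aᵢ(τ)) — smooth paths in a compact
sub-extremal box [m₀, 1/m₀] × {|a| ≤ χM}, χ < 1, all derivatives → 0, otherwise FREE TO DRIFT —
tends to 0 on every truncated slab, only the EXTERIOR parts {r > r₊(M(t*),a(t*))} entering O (C′ of
refuter rattack-14737-0, rev 14), plus
one flat chart with sublinear excised tubes, C² → η, wave-zone weights, finite radiation energy,
chart localisation, separation,
covering, growing-radii exhaustiveness, complete null rays from Σ inside closure(exteriorOf(flat
late image)) and future-oriented chart time (the revised Statement's clauses, re-type T2 p126844, in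
drifting-label currency). H (ShapeSettledFinalEra, imported half):
TAME-Christodoulou-generically (IsTameChristodoulouGeneric, one fixed end; re-type T2) an MGHD
exists and every MGHD has complete 𝓘⁺ and satisfies Q. M (MassFreezing, card K1+K2): under Q each
label Mᵢ(τ) converges — every hole has its own Bondi mass. S (SpinFreezing, card K3): under Q each
aᵢ(τ) converges — capture filters
specific angular momentum. R (Reanchoring, crux): Q with convergent labels re-anchors to the
Statement's C² decomposition — frozen boosted-Kerr EXTERIOR charts {r > r₊(Mᵢ∞, aᵢ∞)},
horizon-normalised, exhausting O′ = exteriorOf(charted) with honest radii, rays in closure O′,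
future-oriented.
Lean: `ShapeSettledFinalEra ∧ MassFreezing ∧ SpinFreezing ∧ Reanchoring`

## Assembly
Pure logic, sorry-free in Sketch.lean / glue.lean (theorem `closes`, lean check rc 0, axioms
propext, Classical.choice, Quot.sound):
Tame Christodoulou genericity `IsTameChristodoulouGeneric 𝓓 P 1 = HasTameCodimAtLeastIn 𝓓 {d ∈ 𝓓 |
¬P d} 1` is monotone under pointwise
implication on 𝓓 (the end e and the tame immersed family F of H serve verbatim). Fix X and an
admissible D with H's property; for each MGHD 𝒟, H gives complete 𝓘⁺ and the binders of Q;
MassFreezing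
and SpinFreezing give convergence of every label; Reanchoring returns the Statement's settling
clause; so the Statement's exceptional
set lies inside H's and H's escaping curves serve verbatim. Hypotheses of `closes` =
{ShapeSettledFinalEra, MassFreezing, SpinFreezing, Reanchoring}, all of kind crux (gate native check
OK, crux-only, 2026-08-16T04:02Z; re-elaborated against the revised Statement at rev 14,
route-repair 49f6627b: lean check rc 0, same axioms). TorqueFilterFixedFrequency, NullCaptureCone,
AlmostMonotoneLimit are
rungs of M and S, not hypotheses of `closes`.

Rationale: WHY THIS LINE. Mechanism (card every-hole-has-its-own-bondi-mass): put a sphere Sᵢ(t) = {|y − ξᵢ(t)|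
= βt} around each hole with β strictly between
the holes' relative speeds and the speed of light — the Martel–Merle–Tsai move
(doi:10.1007/s00220-002-0723-2 §3; hyperbolic
transplants arXiv:1504.01595 p. 17, arXiv:1210.7953, doi:10.1007/s00220-023-04904-5) — so that the
quasi-local energy inside Sᵢ(t)
(Landau–Lifshitz in the flat chart, LandauLifshitz1975 §§96, 101, or Hawking mass, arXiv:1002.0927)
is ALMOST MONOTONE with errors
summable for causal reasons (other holes at distance ≥ ct, luminosities L¹, drizzle finite, tidal
work ~t⁻²): each hole acquires its
own Bondi mass and mass-loss law, hence Mᵢ(τ) converges; and whatever crosses a sub-extremal horizon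
came through the centrifugal
barrier, so absorbed angular momentum per incident energy is ≤ C(χ)M (capture cone |b| < 7M;
fixed-frequency transmission,
DafermosRodnianskiShlapentokhrothman2014, TeukolskyPress1974, arXiv:1501.06570), hence aᵢ(τ)
converges. Imported areas:
dispersive multi-soliton stability (localised almost-monotone functionals), quasi-local mass,
black-hole scattering theory.
What the 46 sibling routes do not do: every capture/settling crux either starts close to ONE Kerr or
fixes (Mᵢ, aᵢ) in its ansatz
(EIHFluxBalance, DissipativeFinalMotions, PhotonSphereCapacity) or upgrades drifting labels by a
renormalised BOOTSTRAP at one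
accuracy (RenormalisedDrift.DriftCapture); here the labels are frozen by BUDGETS ALONE from shape
convergence, with no rate, no
multiplier and no symmetry, and the fixed-frequency torque filter is typed as its own refutable
crux. Negatives index: empty (0).

RANKED CRUXES. #2 MassFreezing (crux) — (card K1 + K2 — EVERY HOLE HAS ITS OWN BONDI MASS, in the
form the Statement consumes) for every admissible datum, every MGHD with complete 𝓘⁺ and every
shape-settled final era with drifting labels Q (binders N, m₀, χ, τ₀, δ₀, M, a, motion, U, Ψ, ρ, U₀,
Ψ₀, O; clauses, rev 14 = Q′: box and adiabatic SMOOTH labels with all derivatives → 0,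
future-directed pairwise distinct 4-velocities, collar domains, late hole charts IsLateChart … univ
with only the EXTERIOR parts {r > r₊(M(t*),a(t*))} entering O (C′ of rattack-14737-0), C^k shape
convergence to the adiabatic boosted Kerr–Schild background on every truncated slab for EVERY k,
separation, sublinear excision, flat late chart C² → η, O = exteriorOf(flat late image ∪ exterior
parts), complete null rays from Σ in closure(exteriorOf(Ψ₀{x⁰ > τ₁})) ∀ τ₁ ≥ τ₀, push-forwards of
Λᵢ·Kerr.timeVector and ∂₀ eventually future-directed, covering, chart localisation, wave-zone
weights (1+d)^{9/10}|h|, (1+d)|D^{1,2}h| ≤ C, slab energy ∫|Dh|² ≤ C, growing-radii exhaustiveness):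
each mass label converges, ∃ Mᵢ∞, Mᵢ(τ) → Mᵢ∞. Proof plan: the Landau–Lifshitz / Hawking energy
Eᵢ(t) inside the receding sphere |y − ξᵢ(t)| = βt is almost monotone with summable errors (K1),
Eᵢ(t) − γᵢMᵢ(τ(t)) → 0 (K2), AlmostMonotoneLimit. [difficulty: XL] (why it might fail: Q gives
sup-weights and one energy bound only: the LL energy of a sphere of radius βt is gauge-fragile at
linear level (∮∂h dS = O(t) without harmonic cancellations), and an eternal log-slow mass creep fed
by re-entering backscatter is excluded only if the influx through Sᵢ is L¹ — not in Q.)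
[doi:10.1007/s00220-002-0723-2, arXiv:1504.01595, LandauLifshitz1975, arXiv:0804.1174,
arXiv:1002.0927, Christodoulou2008, arXiv:gr-qc/0407042]
#3 ShapeSettledFinalEra (crux) — (imported half, the large-data front end) for every connected
Hausdorff second-countable 3-manifold X, TAME-Christodoulou-generically (IsTameChristodoulouGeneric
… 1, tame codimension ≥ 1 on one fixed end; re-type T2, rev 14) in admissibleVacuumData X: an MGHD
exists, and every MGHD has complete 𝓘⁺ (HasCompleteNullInfinity) and admits a shape-settled final
era with drifting labels Q′ (same block as in MassFreezing, under ∃). Carries weak cosmic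
censorship, finiteness of the number of holes, near-zone SHAPE convergence to the Kerr FAMILY
(ω-limit / capture routes), the far chart with wave-zone weights, hyperbolic final motions and chart
localisation; it does NOT assert that masses or spins converge. [difficulty: open-problem] (why it
might fail: Beyond FSC content (censorship, finite N, no eternal non-Kerr dynamics) it asserts
generic HYPERBOLIC final motions (bound/parabolic sub-clusters must merge or have positive
codimension — unproved in GR), C^k-for-every-k closeness on a collar INSIDE the horizon whose
labelled exterior part must clear the true 𝓗⁺, (1+d)-weights that log tails may violate, and no
future-complete null ray inside a hole.) [DafermosLuk2017, Christodoulou1999, arXiv:2104.08222,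
arXiv:2205.14808, doi:10.1016/0022-0396(76)90101-7, arXiv:1710.01722, KehleUnger2024]
#4 SpinFreezing (crux) — (card K3 — CAPTURE FILTERS SPECIFIC ANGULAR MOMENTUM) under the same
hypotheses Q: each spin label converges, ∃ aᵢ∞, aᵢ(τ) → aᵢ∞ (the axis is fixed by the boosted
Kerr–Schild chart; aᵢ is the signed spin along it). Proof plan: the angular momentum entering hole i
after hole time τ is ≤ C(χ)Mᵢ × (energy incident after τ) + summable tidal torque, the incident
energy → 0 by the receding-sphere budget of MassFreezing, the filter constant from
TorqueFilterFixedFrequency / NullCaptureCone; J_ADM is never used (it is undefined on the admissible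
class). [deps: MassFreezing, TorqueFilterFixedFrequency] [difficulty: XL] (why it might fail:
Absorbed J/E = m/ω is unbounded mode by mode; zero-frequency (memory-type) angular-momentum exchange
with the far field and quasi-static tidal torques ∝ (Ω_H − Ω_tide)M⁵|ℰ|² carry almost no energy, so
'incident energy → 0' does not bound them and Q offers no rate to sum them.) [TeukolskyPress1974,
DafermosRodnianskiShlapentokhrothman2014, arXiv:gr-qc/0407050, arXiv:gr-qc/0407042,
arXiv:1501.06570, arXiv:2007.07211]
#5 TorqueFilterFixedFrequency (crux) — (card's Fastest refutation, typed) for every χ < 1 there is C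
such that for all sub-extremal Kerr (M, a), |a| ≤ χM, all real ω ≠ 0, m ∈ ℤ and admissible Λ
(Kerr.IsAdmissibleTriple: Λ ≥ |m|(|m|+1), Λ ≥ 2|amω|), every solution u of Carter's radial ODE
(Δ/(r²+a²)) d/dr((Δ/(r²+a²)) du/dr) + (ω² − V)u = 0 on r > r₊ with V = Kerr.sepPotential (DRSR Prop.
5.2.1) which is INGOING at the horizon (|u|² → T2 as r ↓ r₊ and conserved current Im(ū u_{r*}) = −(ω
− mω₊)T2) and has free asymptotics at infinity ((|u_{r*}|² + ω²|u|²)/(2ω²) → S = |A_in|² + |A_out|²)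
satisfies |m|·|ω − mω₊|·T2 ≤ C·M·ω²·|A_in|², |A_in|² = (S + (ω − mω₊)T2/ω)/2: the angular momentum
absorbed through 𝓗⁺ per unit INCIDENT energy is at most C(χ)M, superradiant amplification included.
[difficulty: M] (why it might fail: No quantitative transmission bound is in print near the
threshold ω ≈ mω₊ or in DRSR's bounded-frequency trapped regime; admissible Λ is not tied to true
eigenvalues, so Λ ≈ |m|(|m|+1) at ω ≈ |m|/(5M) may transmit more than the capture cone suggests;
C(χ) may blow up as χ → 1.) [DafermosRodnianskiShlapentokhrothman2014, TeukolskyPress1974,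
arXiv:1501.06570, arXiv:2007.07211, arXiv:2302.08916]
#6 RecedingEnergyAlmostMonotone (crux; typed at rev 8 after refuted-misstated) — (card K1) under Q ∧
W, W = the flat chart is wave-harmonic on the late far region (∂_μ𝔤^{μν}(η + h) = 0 for τ₀ < x⁰,
i.e. □_g x^ν = 0), for a hole i and a speed β with 0 < β, ‖vᵢ‖ + β < 1 and 2β < ‖vᵢ − vⱼ‖ for all j
≠ i: the Landau–Lifshitz energy Eᵢ(t) = P⁰(t, ξᵢ(t), βt) of η + h on the receding coordinate sphere
(quasiLocalMomentum, LL (96.16); the Hawking reading is withdrawn) is bounded below and almost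
monotone with a corrector F → 0 for t ≥ T (⇔ Eᵢ converges, by AlmostMonotoneLimit). [deps:
AlmostMonotoneLimit] [difficulty: XL] (why it might fail: W kills co-moving corrugations only:
residual □ζ=0 gauge waves must be tamed by the slab energy; ∮∂h dS over area ~t² is O(t) a priori
(bounded below is claimed, not given); no clause makes the influx through Sᵢ (tails, drizzle, own
backscatter) L¹; Q∧W may clash near the null cone (log terms).) [doi:10.1007/s00220-002-0723-2,
arXiv:math/0112071, arXiv:1504.01595, arXiv:1210.7953, LandauLifshitz1975, Blanchet2024,
Lindblad2017, LindbladRodnianski2010Annals, Szabados2009, arXiv:2304.08455]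
#7 RecedingEnergyIdentification (crux; typed at rev 9 after refuted-misstated, hypotheses IDENTICAL
to K1: Q ∧ W, same β, same LL functional) — (card K2) Eᵢ(t) − γᵢMᵢ((t − cᵢ⁰)/γᵢ) → 0: the
receding-sphere energy identifies the mass label on the central clock (the Q-preserving
wrinkles/re-slicings that shifted it at O(1) all violate W). [deps: RecedingEnergyAlmostMonotone]
[difficulty: XL] (why it might fail: the (1+d)^{9/10} weight lets residual gauge/tail amplitudes
grow like u^{1/10}; the label↔sphere bridge crosses the uncertified gap ρᵢ < |x|, r > Rᵢ(τ); the
central clock presumes labels vary o(1) on [ct, t].) [LandauLifshitz1975, arXiv:gr-qc/9501002,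
LindbladRodnianski2010Annals, arXiv:2109.08434]
#8 Reanchoring (crux; ledger rank 9 = lowest crux priority; rev 14 conclusion = the revised
Statement's settling clause) — for every admissible datum, every MGHD with complete 𝓘⁺ and every Q′:
if every Mᵢ(τ) and every aᵢ(τ) converges then ∃ O′ and a C² FinalStateDecomposition d of O′ =
exteriorOf 𝒟 d.charted with sub-extremal frozen holes (|aᵢ∞| ≤ χMᵢ∞ < Mᵢ∞), RaysStayInClosure 𝒟 O′,
HasExhaustiveCharts d (honest radii) and IsFutureOriented d. Proof plan: d.flatChart = Ψ₀, d.τ₀ =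
some τ₀′ ≥ τ₀ (so O′ ⊇ exteriorOf(Ψ₀{x⁰ > τ₀′}) and Q′'s rays clause transfers by monotonicity; Q′'s
flat orientation clause is (iii) verbatim; (i) is Q′'s 0 < (Λᵢe₀)⁰); d.chart i = Ψᵢ ∘ Φᵢ, Φᵢ the
radial graph map of the frozen exterior {r > r₊∞} onto the part of Uᵢ outside 𝓗⁺ = ∂O ∩ (collar
image) = {r = r₊∞ + ηᵢ(t, ω)} (identity for r ≥ r₊∞ + 1); ηᵢ → 0 in C³ from Q′'s C^k collar
convergence for every k (generators of the achronal boundary ∂O stay in {r ≤ r₊(M(t),a(t))} by (E),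
stable-manifold regularity, κ(Mᵢ∞,aᵢ∞) > 0), so Φᵢ → id in C³ and joint smoothness of the
Kerr–Schild field in (M, a, x) (Kerr.contDiffAt_scalarH_comp) plus labels → (M∞, a∞) with all
derivatives → 0 give C² convergence to the FROZEN background and (ii) by continuity of
future-directedness along Λᵢ(V_{M(t),a(t)} → V_{M∞,a∞}); honest radii by the diagonal argument
(truncDeviationCk_mono); covering/exhaustiveness for d from Q′'s (C)/(E) (O′ ⊆ O; uncertified points
are d.o.c. points reached along outgoing null directions). [difficulty: XL] (why it might fail:
horizon normalisation is forced (accretion Mᵢ ↑ Mᵢ∞ keeps 𝓗⁺ inside {r = r₊∞}, Hawking–Ellis Fig.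
59; an uncovered d.o.c. sliver at chart time > τ₁ breaks HasExhaustiveCharts) and needs ∂O ∩ collar
to be a C³-small graph — true in the expected picture, but its derivation from Q′ is stable-manifold
theory for the null generator flow plus J⁺(Σ)/I⁻ bookkeeping in near-Kerr causal geometry, none of
it in Lean; if Q′-developments with rough horizons existed R would fail there.) [HawkingEllis1973,
arXiv:2104.08222, arXiv:gr-qc/0001003, AshtekarKrishnan2004, arXiv:gr-qc/0508107, arXiv:0811.0354,
DafermosLuk2017]
#9 NullCaptureCone (support) — (card P3, geometric-optics skeleton of the torque filter) a null
geodesic of sub-extremal Kerr (M, a) with constants (E > 0, L_z, Q ≥ 0) and |L_z| ≥ 7ME has a radial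
turning point or forbidden radius outside the horizon: ∃ r > r₊ with R(r) = (E(r²+a²) − aL)² − Δ((L
− aE)² + Q) ≤ 0, so it cannot come in from infinity and cross 𝓗⁺ (the critical impact parameters
satisfy max |b_c| = 7M, attained only at extremality, retrograde, r = 4M). [difficulty:
provable-now] [Bardeen1973, doi:10.1023/A:1026286607562, Chandrasekhar1983]
#9 AlmostMonotoneLimit (support) — (card P1) a real function bounded below on [T, ∞) with E(t₂) ≤
E(t₁) + F(t₁) for T ≤ t₁ ≤ t₂ and F → 0 has a limit at +∞ (limsup ≤ liminf; ten lines). [difficulty: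
provable-now] [doi:10.1007/s00220-002-0723-2]

TWO-LAYER PLAN. Foreseen glued splits, nothing filed now (D-0019). MassFreezing ⇐
RecedingEnergyAlmostMonotone → RecedingEnergyIdentification → WaveRegauging →
MassFreezing (k = 3; glue via AlmostMonotoneLimit_holds; K1 (rev 8) and K2 (rev 9) typed over Q ∧ W
with the LL energy Eᵢ(t) of the receding coordinate sphere IN A WAVE-HARMONIC FLAT CHART;
WaveRegauging = under Q the flat chart can be re-gauged to satisfy W keeping Q's flat-chart clauses
— the
conclusion of MassFreezing lives in the hole charts, so the change of flat chart costs nothing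
downstream). SpinFreezing ⇐ IncidentEnergyDecay → TorqueBudget → SpinFreezing (incident energy on
hole i
after τ tends to 0, from K1's balance; |ΔJᵢ| ≤ C(χ)Mᵢ·incident energy + summable tidal torque, from
TorqueFilterFixedFrequency
lifted to the Teukolsky/linearised-gravity level and then to the nonlinear near zone via a
quasi-local spin comparable to aᵢMᵢ,
arXiv:gr-qc/0407042). ShapeSettledFinalEra ⇐ (another route's generic capture / ω-limit statement) →
HyperbolicFinalMotions →
ShapeSettledFinalEra if a sibling route lands shape convergence first.

KILL CRITERIA. A vacuum MGHD satisfying Q whose mass label drifts forever (e.g. an N = 1 development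
with eternal slow accretion of its own
backscatter, or an N = 2 hyperbolic pair exchanging energy at a non-summable rate) refutes
MassFreezing: close `refuted:MassFreezing`
— the budget architecture is dead and the card is refuted. A refutation of SpinFreezing alone
(eternal spin drift at frozen mass,
e.g. by zero-frequency torques) ⇒ pivot: keep MassFreezing, replace S by the spectral-gap card's
log-time mechanism
(log-time-price-gap-three-annuli) via a new crux. TorqueFilterFixedFrequency refuted by an explicit
(ω, m, Λ) family with ratio →
∞ at fixed χ ⇒ S must be re-sourced from the first law dM ≥ Ω_H dJ (prograde half only survives):
restate S with a one-sided
conclusion or close. ShapeSettledFinalEra refuted through one of MY clauses (collar, weights 9/10,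
hyperbolic motions,
localisation) ⇒ `--restate` with the weaker clause; refuted through its FSC content ⇒ every route of
the summit dies with it. Reanchoring refuted (a Q′-development with convergent labels admitting NO
exhaustive, future-oriented frozen-exterior C² decomposition) ⇒ the engine M, S is untouched:
`--restate` R with the missing structure moved INTO Q′ (H carries it); never weaken the Statement
side.
If RenormalisedDrift.DriftCapture is PROVED, this route's engine is mooted for settling but
MassFreezing/SpinFreezing remain the
budget-only decoupling lemma; if AdiabaticTracking-type fronts land elsewhere, H reduces to
hyperbolic motions + weights.
RecedingEnergyAlmostMonotone refuted AGAIN under W: by a residual-gauge witness (□_g ζ = 0, finite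
slab energy) ⇒ one last gauge repair (average P⁰ over radii
R ∈ [βt, β′t], or replace the coordinate sphere by a level set of an optical function of the
harmonic chart), else K1/K2 are dropped and MassFreezing is attacked
through horizon-area convergence (retriage signal 2: A(Mᵢ, aᵢ) converges under Q) plus a one-sided
first-law budget; by a genuine non-summable influx compatible with
Q ∧ W (e.g. N = 1 eternal accretion of backscatter) ⇒ that is the MassFreezing kill above.

NOT DECOMPOSED YET. K1 (rev 8) and K2 (rev 9) are both typed over Q ∧ W with the single LL
functional and the central clock; WaveRegauging
(existence of a wave-harmonic re-gauging of Ψ₀ keeping Q's flat-chart clauses — weakest usable form: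
harmonic only on a subluminal cone {‖x̲ − ξᵢ(x⁰)‖ < β′x⁰},
‖vᵢ‖ + β′ < 1, around each hole, which is all K1's proof touches; Lindblad2017 §1 asymptotics h ~
H(r*−t, ω)/(t+r) + K/(t+r), |K| ≲ ε ln, keep (1+d)^{9/10}|h| and
(1+d)|Dh| bounded) is not filed before MassFreezing is split; Q′ (rev 14, route-repair 49f6627b
after the Statement re-type T2, p126844) is now carried verbatim by H, M, S, K1, K2, R: it folds in
the C′ of refuter rattack-14737-0 (IsLateChart … univ, only exterior parts in O — the rev-1 block
was unsatisfiable for every slowly rotating hole), tenure signal 3 in the robust form C^k collar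
convergence for EVERY k with smooth labels (R needs the 𝓗⁺-graph in C³), and the revised Statement's
rays / future-orientation clauses in drifting-label currency (honest radii are R's output,
derivable); signatures compressed below the 4000-char cap by untyped lets, content unchanged; a
`ShapeSettledPackage` bundling Q′ is still the first definition request; the nonlinear
torque budget (Teukolsky level and quasi-local spin); the N = 1 special case of MassFreezing (an
isolated hole cannot creep: the
cheapest sub-case, a natural first split child); the choice β ∈ (max relative speed, 1) and the
retarded sweep-up calibration
(card P2); constants 9/10 (weight) and 2δ₀ < m₀ (collar) are fixed in Q, not items; ΣᵢEᵢ(∞) = lim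
M_B (no in-flight defect) is NOT
needed for the Statement and is left to cards tsiolkovsky-at-scri / no-soft-geons.

CHEAPEST FALSIFIER. TorqueFilterFixedFrequency by one afternoon of radial ODEs (kit): a = 0.9M and a
= 0.99M, m = ℓ = 2 (Λ from the spheroidal
eigenvalue and also the bare admissible floor Λ = 6), ω swept through (0, 3/M) including ω ↑ 2ω₊ and
ω ↓ 2ω₊: integrate Carter's
ODE from the ingoing horizon asymptotics, read off A_in, A_out, and plot |m(ω −
mω₊)|T2/(ω²|A_in|²)/M; any family exceeding ~50
kills the filter (card: 'if the ratio exceeds 50M the filter leaks'). Not run here (planner seat, no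
kit). Second: NullCaptureCone is
decidable by `nlinarith`-level algebra — a counterexample (|b| ≥ 7M captured at some |a| < M) would
also kill the optics half. Third (K1 after rev 8): rerun the refuter's exact LL computation
(llgauge_pure.py, attached to
stmt-13656) with a RESIDUAL harmonic gauge wave instead of the corrugation — exact Schwarzschild
exterior (Kehle–Unger arXiv:2304.08455 Cor. 2) in harmonic coordinates plus
an outgoing finite-energy solution of □_g ζ = 0 modulated in retarded time; a non-decaying (or
non-summably oscillating) shift of P⁰(t, 0, βt) under W kills the
LL-in-harmonic-gauge reading of K1/K2 for good.

NUMBERS. Superradiant amplification maxima: 0.4% (scalar), 4.4% (EM), 138% (gravitational, ℓ = m =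
2, a → M) — arXiv:1501.06570 §3,
TeukolskyPress1974; capture impact parameters: Schwarzschild b_c = 3√3M ≈ 5.196M, extremal Kerr
prograde 2M, retrograde 7M
(Bardeen1973); 1/Ω_H = 2Mr₊/a ≥ 2M; tidal torque on a slowly rotating hole ∝ M⁵ΩH-terms × |ℰ|²
(arXiv:gr-qc/0407050) with ℰ ~ Mⱼ/d³,
d ≥ ct ⇒ ~t⁻⁶. Kerr stability in print: |a| ≪ M (arXiv:2104.11857, arXiv:2205.14808); linear waves
all |a| < M
(DafermosRodnianskiShlapentokhrothman2014). Items at open: 8 typed (4 cruxes, 3 support, assembly) +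
2 informal cruxes = 10 ≤ 15.
Gauge artefact that refuted the informal K1: ΔP⁰ = κa², M-independent, non-decaying
(Evidence13656.md on stmt-13656). After rev 9 + the 2026-08-16 re-badge: 10 typed = 7 cruxes (H, M,
S, TorqueFilter, K1, K2, R) + 2 support + assembly ≤ 15; cruxes AT THE CAP 7 — tenure signal:
re-attach K1/K2 under MassFreezing by `--split` (glue K1 → K2 → MassFreezing via
AlmostMonotoneLimit) to return to 5. Rev 14 (Statement re-type T2 + Q′ re-sync): six restates (H, M,
S, K1, K2, R), still 10 typed items, 7 cruxes; `closes` re-certified (lean check rc 0, axioms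
propext/Classical.choice/Quot.sound).

DEFINITION REQUESTS. (1) `ShapeSettledPackage` (Literature/Geometry/Lorentzian, pattern of
FinalEraPackage / AdiabaticTracking): bundle the 14 binders and the clauses of Q′ so that the six
items restate as `∀ p : ShapeSettledPackage 𝒟, …`. (2) For K1/K2:
`LandauLifshitz.quasiLocalMomentum (fun z ↦ Minkowski.bilin + h z) t (ξᵢ t) (β t) 0`
(LandauLifshitzPseudotensor.lean, imported by the route file since rev 8)
needs no new notion; the Hawking/`timelikeTubeEnergyFlux` variant is withdrawn (refuted reading).
(3) For the nonlinear torque budget: a horizon angular-momentum flux of a test field on exact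
Kerr (pattern of Barriers/…/KleinGordonHorizonFlux.lean) — requested when S is split.

Novelty: Searches (2026-08-15, this seat; searchd hybrid leg rc 75, arXiv/zbMATH legs 0 rows): card's
searches (all FSC cards; crossref
"almost monotonicity quasi-local mass black hole binary" 0/5; galaxy "Bondi mass of each black hole"
0) plus here: `lit search
--source crossref "multi-solitons nonlinear Klein-Gordon stability energy localized cutoff moving
speed"` (8; relevant
doi:10.1017/fms.2014.13 = arXiv:1210.7953, doi:10.1007/s00220-023-04904-5 Chen–Jendrej 2024
asymptotic stability of KG
multi-solitons — the stability-direction hyperbolic transplant, nearest prior art for K1's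
architecture); `lit search --source
crossref "absorption of angular momentum by a Kerr black hole … bound"` (8, none giving a uniform
J/E bound); `lit galaxy search
"superradiant amplification factor" --star all` (1: panama Brito–Cardoso–Pani = arXiv:1501.06570);
`lit galaxy search "angular
momentum absorbed by the black hole per unit incident energy" --star all` (0); `lit frontier
FinalStateConjecture --since 2022` (30;
nearest arXiv:2601.01517, initial-data bookkeeping only); `lit bridges --cross any` (surveys only);
grep of all 46 sibling route
headers for Martel/almost-monotone/Bondi-per-hole (MergerLatticeBudget: GLOBAL Bondi mass + area in
the merger era;
RenormalisedDrift: drifting labels frozen by a renormalised bootstrap, not budgets).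
Nearest prior art found: arXiv:1504.01595 p. 17 and doi:10.1007/s00220-023-04904-5 (moving cut-offs
between soliton and radiation
speeds for wave/KG multi-soliton  [refs: 10.1017/fms.2014.13, 10.1007/s00220-023-04904-5, 10.1103/PhysRevD.31.1815, 1210.7953, 1501.06570, 2601.01517, 1504.01595, gr-qc/0407042, 1601.06809, doi:10.1017/fms.2014.13, doi:10.1007/s00220-023-04904-5, doi:10.1103/PhysRevD.31.1815, TeukolskyPress1974]

Barriers (technique_class: localised-almost-monotonicity, causal-budget, capture-filter): - technique_class: localised-almost-monotonicity, causal-budget, capture-filter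
- Literature.Barriers.FinalStateConjecture.KerrSuperradiance: no Killing energy of Kerr is used for
Eᵢ — the receding spheres sit in the wave zone far outside every ergoregion; superradiance enters
only TorqueFilterFixedFrequency/SpinFreezing, where it is BOUNDED (|A_out|² ≤ 2.38|A_in|² is inside
the constant), not assumed absent.
- Literature.Barriers.FinalStateConjecture.HairyKerrBifurcation: vacuum/massless only and says so:
'radiation outruns the holes' fails for massive fields (group velocity can equal a hole's speed —
MMT's non-degeneracy reappears) and the filter fails for synchronised bound clouds with large
specific angular momentum; the line does not apply to Einstein–Klein–Gordon.
- Literature.Barriers.FinalStateConjecture.KerrLinearHair: same — real-frequency bound states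
neither recede nor tunnel; masslessness enters through speed-1 dispersion and the ω^{2√(Λ+1/4)}
transmission law used in TorqueFilterFixedFrequency.
- Literature.Barriers.FinalStateConjecture.PriceLawTail: no rate is used or produced; summability is
kinematic (d ≥ ct, L¹ luminosity, finite drizzle); tails may re-enter Sᵢ with O(tail²) energy —
conceded as MassFreezing's failure mode, not assumed away.
- Literature.Barriers.FinalStateConjecture.KehrbergerLogarithmicAsymptotics: spheres live at finite
radius βt on each slab; 𝓘⁺ enters only through HasCompleteNullInfinity; the (1+d)^{9/10} weight on
|h| (not (1+d)) is ch

History (route lifecycle, newest last):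
- 2026-08-15T20:07:55Z · rev 3: restated TorqueFilterFixedFrequency (stmt-FinalStateConjecture-14739) — cone repair (route-repair planner): restate TorqueFilterFixedFrequency with Δ = r²−2Mr+a², V = DRSR printed closed form (= Kerr.sepPotential, sepPotential_eq), (planner-rrepair-FinalStateConjecture-RecedingS-aeb872ba-0)
- 2026-08-15T20:10:58Z · rev 4: restated NullCaptureCone (stmt-FinalStateConjecture-14741) — cone repair (route-repair planner): restate the support item NullCaptureCone with Δ = r²−2Mr+a² written out instead of Kerr.delta (defined in Sweep2.lean); the (planner-rrepair-FinalStateConjecture-RecedingS-aeb872ba-0)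
- 2026-08-16T03:41:42Z · rev 8: restated RecedingEnergyAlmostMonotone (stmt-FinalStateConjecture-13656) — repair (route-repair planner 381ce8fe): RecedingEnergyAlmostMonotone (stmt-FinalStateConjecture-13656, informal K1) refuted-misstated by refuter rattack-13656-0 (planner-rrefute-FinalStateConjecture-RecedingS-381ce8fe-0)
- 2026-08-16T03:58:11Z · rev 9: restated RecedingEnergyIdentification (stmt-FinalStateConjecture-13657) — repair (route-repair planner 08c0423d): RecedingEnergyIdentification (stmt-FinalStateConjecture-13657, informal K2) refuted-misstated by rattack-13657-0 / -g2-0 (planner-rrefute-FinalStateConjecture-RecedingS-08c0423d-0)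
- 2026-08-16T23:27:16Z · rev 14: restated ShapeSettledFinalEra (stmt-FinalStateConjecture-14737), MassFreezing (stmt-FinalStateConjecture-14736), SpinFreezing (stmt-FinalStateConjecture-14738), RecedingEnergyAlmostMonotone (stmt-FinalStateConjecture-14532), RecedingEnergyIdentification (stmt-FinalStateConjecture-14577), Reanchoring (stmt-Final (planner-rrepair-FinalStateConjecture-RecedingS-49f6627b-0)
- 2026-08-23T07:21:34Z · DORMANT — reconciler: no traction for 6 d (last activity statement-checked at 2026-08-17T07:23:38Z); parked, not closed — `ledger route dormant route-FinalStateConjecture (operator:999:2712047)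

sub-problem: FinalStateConjecture · status: dormant · opened planner-plancard-FinalStateConjecture-FinalSt-dd810566-0 2026-08-15T19:11:27Z · rev 15 · ledger route-FinalStateConjecture-RecedingSphereBudgets
GENERATED by the gate from the ledger (D-0016/17). Provers cite these decls: `theorem foo : Summit.FinalStateConjecture.FinalStateConjecture.Theses.RecedingSphereBudgets.<Decl> := …` in Summits/FinalStateConjecture/FinalStateConjecture/Theorems/<Name>.lean.
-/

namespace Summit.FinalStateConjecture.FinalStateConjecture.Theses.RecedingSphereBudgets

open scoped BigOperators Topology Manifold Classical MeasureTheory ProbabilityTheory Matrix InnerProductSpace ComplexConjugate ContinuousMap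
open Filter Set Function TopologicalSpace MeasureTheory

attribute [summit_statement] _root_.FinalStateConjecture

-- earlier MassFreezing (stmt-FinalStateConjecture-14736, replaced 2026-08-16T23:27:16Z -> stmt-FinalStateConjecture-17686): retired by None — open Literature.Geometry.Lorentzian in ∀ (X : Type) [TopologicalSpace X] [ChartedSpace E3 X] [IsManifold (𝓡 3) ((⊤ : ℕ∞) : WithTop ℕ∞) X] [T2Space X] [SecondCountableTopology X] [ConnectedSpace X], ∀ D ∈ admissibleVacuumData X, ∀ 𝒟 : VacuumCauchyDevelopment D,
/-- item stmt-FinalStateConjecture-17686 · crux · rank 2 · open · by planner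
why it might fail: Q: |Dh|≲1/d + one energy bound: LL energy of the sphere r=βt is a priori O(t) (TT cancellations + news decay at u=(1−β)t are not in Q); timelike tubes lack a signed flux law; horizon area converges, so an eternal constant-area drift dM≈Ω_H dJ fed by non-L¹ re-entering backscatter is not excluded
sources: doi:10.1007/s00220-002-0723-2, arXiv:math/0112071, arXiv:1504.01595, LandauLifshitz1975, Szabados2009, BrayHaywardMarsSimon2007
[crux] (card K1 + K2 — EVERY HOLE HAS ITS OWN BONDI MASS, in the form the Statement consumes; rev
14: hypothesis block re-synced Q → Q′ after the Statement re-type T2 p126844, route-repair 49f6627b)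
for every admissible datum, every MGHD with complete 𝓘⁺ and every shape-settled final era with
drifting labels Q′ (rev 14 hypothesis block shared verbatim by H, M, S, K1, K2, R; binders N, m₀, χ,
τ₀, δ₀, M, a, motion, U, Ψ, ρ, U₀, Ψ₀, O; clauses: box and adiabatic SMOOTH labels with all
derivatives → 0, orthochronous pairwise distinct 4-velocities, collar domains {r > r₊(M(t*),a(t*)) −
δ₀}, late hole charts IsLateChart … univ with only the EXTERIOR parts ext i = {t* > τ₀, r >
r₊(Mᵢ(t*),aᵢ(t*))} entering O (C′ of refuter rattack-14737-0: the rev-1 block forced interior collar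
points into O and was unsatisfiable for every slowly rotating hole), C^k shape convergence to the
adiabatic boosted Kerr–Schild background on every truncated slab for EVERY k (raised from C² so that
Reanchoring can straighten the event horizon), separation, sublinear excision, flat late chart C² →
η into O, O = exteriorOf 𝒟 (Ψ₀ '' {x⁰ > τ₀} ∪ ⋃ᵢ Ψᵢ '' ext i), future-complete normalised null rays
from Σ stay in closu -/
@[route_item "route-FinalStateConjecture-RecedingSphereBudgets", crux]
def MassFreezing : Prop :=
  open Literature.Geometry.Lorentzian Summit.FinalStateConjecture in ∀ (X : Type) [TopologicalSpace X] [ChartedSpace E3 X] [IsManifold (𝓡 3) (⊤ : ℕ∞) X] [T2Space X] [SecondCountableTopology X] [ConnectedSpace X], ∀ D ∈ admissibleVacuumData X, ∀ 𝒟 : VacuumCauchyDevelopment D, 𝒟.IsMaximal → HasCompleteNullInfinity 𝒟.toCauchyDevelopment → ∀ (N : ℕ) (m₀ χ τ₀ δ₀ : ℝ) (M a : Fin N → ℝ → ℝ) (motion : Fin N → lorentzGroup × E4) (U : Fin N → Opens E4) (Ψ : ∀ i, U i → 𝒟.carrier) (ρ : Fin N → ℝ → ℝ) (U₀ : Opens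 E4) (Ψ₀ : U₀ → 𝒟.carrier) (O : Set 𝒟.carrier), (let S := 𝒟.toSpacetime; let 𝒞 := 𝒟.toCauchyDevelopment; let J := 𝒟.metric.causalPast 𝒟.timeOrientation; let L := fun i ↦ ((motion i).1 : E4 ≃L[ℝ] E4); let p := fun i ↦ poincareInv (motion i).1 (motion i).2; let e := fun i ↦ L i (E4.basisVector 0); let B : Fin N → ModelBackground := fun i ↦ ⟨U i, fun x ↦ boostedKerrBilin (motion i).1 (motion i).2 (M i (p i x 0)) (a i (p i x 0)) x, fun x ↦ p i x 0, fun x ↦ Kerr.radius (a i (p i x 0)) (p i x)⟩; let ξ := fun i (t : ℝ) ↦ E4.spatial (((t - (motion i).2 0) / e i 0) • e i + (motion i).2); let B₀ := Minkowski.backgroundOn U₀; let h := S.deviationExtend B₀ Ψ₀; let ext := fun i ↦ (B i).lateRegion τ₀ ∩ {x | Kerr.rPlus (M i (p i x.1 0)) (a i (p i x.1 0)) < (B i).radius x.1}; (0 < m₀ ∧ 0 ≤ χ ∧ χ < 1 ∧ 0 < δ₀ ∧ 2 * δ₀ < m₀) ∧ (∀ i, ContDiff ℝ (⊤ : ℕ∞)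 (M i) ∧ ContDiff ℝ (⊤ : ℕ∞) (a i) ∧ (∀ t, m₀ ≤ M i t ∧ M i t ≤ m₀⁻¹ ∧ |a i t| ≤ χ * M i t) ∧ ∀ n : ℕ, 1 ≤ n → Tendsto (iteratedDeriv n (M i)) atTop (𝓝 0) ∧ Tendsto (iteratedDeriv n (a i)) atTop (𝓝 0)) ∧ (∀ i, 0 < e i 0) ∧ Function.Injective e ∧ (∀ i, (U i : Set E4) = p i ⁻¹' {y : E4 | Kerr.rPlus (M i (y 0)) (a i (y 0)) - δ₀ < Kerr.radius (a i (y 0)) y}) ∧ (∀ i, S.IsLateChart (B i) Set.univ τ₀ (Ψ i) ∧ Ψ i '' ext i ⊆ O) ∧ (∀ i (k : ℕ) (R : ℝ), Tendsto (S.truncDeviationCk (B i) (Ψ i) k R) atTop (𝓝 0)) ∧ (∀ R : ℝ, ∃ τ₁, Pairwise (Disjoint on fun i ↦ Ψ i '' (B i).truncLateRegion τ₁ R)) ∧ (∀ i, Tendsto (fun t ↦ ρ i t / t) atTop (𝓝 0)) ∧ {x : E4 | τ₀ < x 0 ∧ ∀ i, ρ i (x 0) < E4.spatialNorm (p i x)}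 ⊆ ↑U₀ ∧ S.IsLateChart B₀ O τ₀ Ψ₀ ∧ Tendsto (S.deviationCk B₀ Ψ₀ 2) atTop (𝓝 0) ∧ O = exteriorOf 𝒞 (Ψ₀ '' B₀.lateRegion τ₀ ∪ ⋃ i, Ψ i '' ext i) ∧ (∀ τ₁ ≥ τ₀, RaysStayInClosure 𝒞 (exteriorOf 𝒞 (Ψ₀ '' B₀.lateRegion τ₁))) ∧ (∀ i (ϱ : ℝ), ∀ᶠ τ in atTop, ∀ x ∈ (B i).truncTimeSlab ϱ τ, 𝒟.timeOrientation.IsFutureDirected (mfderiv 𝓘(ℝ, E4) (𝓡 4) (Ψ i) x (L i (Kerr.timeVector (M i (p i x.1 0)) (a i (p i x.1 0)) (p i x.1))))) ∧ (∀ᶠ τ in atTop, ∀ x ∈ B₀.timeSlab τ, 𝒟.timeOrientation.IsFutureDirected (mfderiv 𝓘(ℝ, E4) (𝓡 4) Ψ₀ x (E4.basisVector 0))) ∧ O \ ((⋃ i, Ψ i '' (B i).lateRegion τ₀) ∪ Ψ₀ '' B₀.lateRegion τ₀) ⊆ J ((⋃ i, Ψ i '' (B i).timeSlab τ₀) ∪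 Ψ₀ '' B₀.timeSlab τ₀) ∧ (∃ C₁ C₂ : ℝ, ∀ i (x : U i) (y : U₀), τ₀ < (B i).time x.1 → Ψ i x = Ψ₀ y → ‖E4.spatial y.1 - ξ i (y.1 0)‖ ≤ C₂ * (B i).radius x.1 + C₁) ∧ (∃ C_W : ℝ, ∀ᶠ τ in atTop, ∀ x : U₀, x.1 0 = τ → let w := 1 + ⨅ i, ‖E4.spatial x.1 - ξ i τ‖; w ^ (9 / 10 : ℝ) * ‖h x.1‖ ≤ C_W ∧ ∀ m : ℕ, 1 ≤ m → m ≤ 2 → w * ‖iteratedFDeriv ℝ m h x.1‖ ≤ C_W) ∧ (∃ C_E : ℝ, ∀ᶠ τ in atTop, ∫⁻ y in {y : E3 | E4.ofTimeSpace τ y ∈ U₀}, ‖iteratedFDeriv ℝ 1 h (E4.ofTimeSpace τ y)‖ₑ ^ 2 ≤ ENNReal.ofReal C_E) ∧ ∃ R : Fin N → ℝ → ℝ, (∀ i, Tendsto (fun τ ↦ S.truncDeviationCk (B i) (Ψ i) 2 (R i τ) τ) atTop (𝓝 0)) ∧ ∀ τ₁ > τ₀, O \ (Ψ₀ '' B₀.lateRegion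 τ₁ ∪ ⋃ i, Ψ i '' {x | τ₁ < (B i).time x.1 ∧ (B i).radius x.1 ≤ R i ((B i).time x.1)}) ⊆ J (Ψ₀ '' B₀.timeSlab τ₁ ∪ ⋃ i, Ψ i '' (B i).truncTimeSlab (R i τ₁) τ₁)) → ∀ i, ∃ Mi : ℝ, Tendsto (M i) atTop (𝓝 Mi)

-- earlier ShapeSettledFinalEra (stmt-FinalStateConjecture-14737, replaced 2026-08-16T23:27:16Z -> stmt-FinalStateConjecture-17685): retired by None — open Literature.Geometry.Lorentzian in ∀ (X : Type) [TopologicalSpace X] [ChartedSpace E3 X] [IsManifold (𝓡 3) ((⊤ : ℕ∞) : WithTop ℕ∞) X] [T2Space X] [SecondCountableTopology X] [ConnectedSpace X], InitialDataSet.IsChristodoulouGeneric (admissibleVacuu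
/-- item stmt-FinalStateConjecture-17685 · crux · rank 3 · open · by planner
why it might fail: Beyond FSC content (censorship, large-data Kerr stability, finite N) it asserts generic HYPERBOLIC final motions (bound sub-clusters unexcluded in GR), C^k ∀k closeness on a collar INSIDE r₊ whose labelled exterior part must clear 𝓗⁺, log-tail-fragile weights, no complete null ray inside a hole.
sources: Christodoulou1999, DafermosLuk2017, arXiv:2104.08222, arXiv:2205.14808, KlainermanSzeftel2023, MarchalSaari1976
[crux] (imported half, the large-data front end; rev 14: TAME genericity and Q′ after the Statement
re-type T2 p126844 and the C′ of refuter rattack-14737-0) for every connected Hausdorff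
second-countable 3-manifold X, tame-Christodoulou-generically
(InitialDataSet.IsTameChristodoulouGeneric … 1: through every exceptional admissible datum passes an
injective one-parameter family of admissible data, tame on ONE fixed asymptotically flat end and
immersed at 0, all of whose other members are good) in admissibleVacuumData X: an MGHD exists, and
every MGHD has complete 𝓘⁺ (HasCompleteNullInfinity) and admits a shape-settled final era with
drifting labels Q′ (rev 14 hypothesis block shared verbatim by H, M, S, K1, K2, R; binders N, m₀, χ,
τ₀, δ₀, M, a, motion, U, Ψ, ρ, U₀, Ψ₀, O; clauses: box and adiabatic SMOOTH labels with all
derivatives → 0, orthochronous pairwise distinct 4-velocities, collar domains {r > r₊(M(t*),a(t*)) −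
δ₀}, late hole charts IsLateChart … univ with only the EXTERIOR parts ext i = {t* > τ₀, r >
r₊(Mᵢ(t*),aᵢ(t*))} entering O (C′ of refuter rattack-14737-0: the rev-1 block forced interior collar
points into O and was unsatisfiable for every slowly rotating hole), C^ -/
@[route_item "route-FinalStateConjecture-RecedingSphereBudgets", crux]
def ShapeSettledFinalEra : Prop :=
  open Literature.Geometry.Lorentzian Summit.FinalStateConjecture in ∀ (X : Type) [TopologicalSpace X] [ChartedSpace E3 X] [IsManifold (𝓡 3) (⊤ : ℕ∞) X] [T2Space X] [SecondCountableTopology X] [ConnectedSpace X], InitialDataSet.IsTameChristodoulouGeneric (admissibleVacuumData X) (fun D ↦ (∃ 𝒟 : VacuumCauchyDevelopment D, 𝒟.IsMaximal) ∧ ∀ 𝒟 : VacuumCauchyDevelopment D, 𝒟.IsMaximal → HasCompleteNullInfinity 𝒟.toCauchyDevelopment ∧ ∃ (N : ℕ) (m₀ χ τ₀ δ₀ : ℝ) (M a : Fin N → ℝ → ℝ) (motion : Fin N → lorentzGroup × E4) (U : Fin N → Opens E4) (Ψ : ∀ i, U i → 𝒟.carrier) (ρ : Fin N → ℝ → ℝ)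 (U₀ : Opens E4) (Ψ₀ : U₀ → 𝒟.carrier) (O : Set 𝒟.carrier), (let S := 𝒟.toSpacetime; let 𝒞 := 𝒟.toCauchyDevelopment; let J := 𝒟.metric.causalPast 𝒟.timeOrientation; let L := fun i ↦ ((motion i).1 : E4 ≃L[ℝ] E4); let p := fun i ↦ poincareInv (motion i).1 (motion i).2; let e := fun i ↦ L i (E4.basisVector 0); let B : Fin N → ModelBackground := fun i ↦ ⟨U i, fun x ↦ boostedKerrBilin (motion i).1 (motion i).2 (M i (p i x 0)) (a i (p i x 0)) x, fun x ↦ p i x 0, fun x ↦ Kerr.radius (a i (p i x 0)) (p i x)⟩; let ξ := fun i (t : ℝ) ↦ E4.spatial (((t - (motion i).2 0) / e i 0) • e i + (motion i).2); let B₀ := Minkowski.backgroundOn U₀; let h := S.deviationExtend B₀ Ψ₀; let ext := fun i ↦ (B i).lateRegion τ₀ ∩ {x | Kerr.rPlus (M i (p i x.1 0)) (a i (p i x.1 0)) < (B i).radius x.1}; (0 < m₀ ∧ 0 ≤ χ ∧ χ < 1 ∧ 0 < δ₀ ∧ 2 * δ₀ < m₀) ∧ (∀ i, ContDiff ℝ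 (⊤ : ℕ∞) (M i) ∧ ContDiff ℝ (⊤ : ℕ∞) (a i) ∧ (∀ t, m₀ ≤ M i t ∧ M i t ≤ m₀⁻¹ ∧ |a i t| ≤ χ * M i t) ∧ ∀ n : ℕ, 1 ≤ n → Tendsto (iteratedDeriv n (M i)) atTop (𝓝 0) ∧ Tendsto (iteratedDeriv n (a i)) atTop (𝓝 0)) ∧ (∀ i, 0 < e i 0) ∧ Function.Injective e ∧ (∀ i, (U i : Set E4) = p i ⁻¹' {y : E4 | Kerr.rPlus (M i (y 0)) (a i (y 0)) - δ₀ < Kerr.radius (a i (y 0)) y}) ∧ (∀ i, S.IsLateChart (B i) Set.univ τ₀ (Ψ i) ∧ Ψ i '' ext i ⊆ O) ∧ (∀ i (k : ℕ) (R : ℝ), Tendsto (S.truncDeviationCk (B i) (Ψ i) k R) atTop (𝓝 0)) ∧ (∀ R : ℝ, ∃ τ₁, Pairwise (Disjoint on fun i ↦ Ψ i '' (B i).truncLateRegion τ₁ R)) ∧ (∀ i, Tendsto (fun t ↦ ρ i t / t) atTop (𝓝 0)) ∧ {x : E4 | τ₀ < x 0 ∧ ∀ i, ρ i (x 0) < E4.spatialNorm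 (p i x)} ⊆ ↑U₀ ∧ S.IsLateChart B₀ O τ₀ Ψ₀ ∧ Tendsto (S.deviationCk B₀ Ψ₀ 2) atTop (𝓝 0) ∧ O = exteriorOf 𝒞 (Ψ₀ '' B₀.lateRegion τ₀ ∪ ⋃ i, Ψ i '' ext i) ∧ (∀ τ₁ ≥ τ₀, RaysStayInClosure 𝒞 (exteriorOf 𝒞 (Ψ₀ '' B₀.lateRegion τ₁))) ∧ (∀ i (ϱ : ℝ), ∀ᶠ τ in atTop, ∀ x ∈ (B i).truncTimeSlab ϱ τ, 𝒟.timeOrientation.IsFutureDirected (mfderiv 𝓘(ℝ, E4) (𝓡 4) (Ψ i) x (L i (Kerr.timeVector (M i (p i x.1 0)) (a i (p i x.1 0)) (p i x.1))))) ∧ (∀ᶠ τ in atTop, ∀ x ∈ B₀.timeSlab τ, 𝒟.timeOrientation.IsFutureDirected (mfderiv 𝓘(ℝ, E4) (𝓡 4) Ψ₀ x (E4.basisVector 0))) ∧ O \ ((⋃ i, Ψ i '' (B i).lateRegion τ₀) ∪ Ψ₀ '' B₀.lateRegion τ₀) ⊆ J ((⋃ i, Ψ i '' (B i).timeSlab τ₀)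 ∪ Ψ₀ '' B₀.timeSlab τ₀) ∧ (∃ C₁ C₂ : ℝ, ∀ i (x : U i) (y : U₀), τ₀ < (B i).time x.1 → Ψ i x = Ψ₀ y → ‖E4.spatial y.1 - ξ i (y.1 0)‖ ≤ C₂ * (B i).radius x.1 + C₁) ∧ (∃ C_W : ℝ, ∀ᶠ τ in atTop, ∀ x : U₀, x.1 0 = τ → let w := 1 + ⨅ i, ‖E4.spatial x.1 - ξ i τ‖; w ^ (9 / 10 : ℝ) * ‖h x.1‖ ≤ C_W ∧ ∀ m : ℕ, 1 ≤ m → m ≤ 2 → w * ‖iteratedFDeriv ℝ m h x.1‖ ≤ C_W) ∧ (∃ C_E : ℝ, ∀ᶠ τ in atTop, ∫⁻ y in {y : E3 | E4.ofTimeSpace τ y ∈ U₀}, ‖iteratedFDeriv ℝ 1 h (E4.ofTimeSpace τ y)‖ₑ ^ 2 ≤ ENNReal.ofReal C_E) ∧ ∃ R : Fin N → ℝ → ℝ, (∀ i, Tendsto (fun τ ↦ S.truncDeviationCk (B i) (Ψ i) 2 (R i τ) τ) atTop (𝓝 0)) ∧ ∀ τ₁ > τ₀, O \ (Ψ₀ ''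 B₀.lateRegion τ₁ ∪ ⋃ i, Ψ i '' {x | τ₁ < (B i).time x.1 ∧ (B i).radius x.1 ≤ R i ((B i).time x.1)}) ⊆ J (Ψ₀ '' B₀.timeSlab τ₁ ∪ ⋃ i, Ψ i '' (B i).truncTimeSlab (R i τ₁) τ₁))) 1

-- earlier SpinFreezing (stmt-FinalStateConjecture-14738, replaced 2026-08-16T23:27:16Z -> stmt-FinalStateConjecture-17687): retired by None — open Literature.Geometry.Lorentzian in ∀ (X : Type) [TopologicalSpace X] [ChartedSpace E3 X] [IsManifold (𝓡 3) ((⊤ : ℕ∞) : WithTop ℕ∞) X] [T2Space X] [SecondCountableTopology X] [ConnectedSpace X], ∀ D ∈ admissibleVacuumData X, ∀ 𝒟 : VacuumCauchyDevelopment D,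
/-- item stmt-FinalStateConjecture-17687 · crux · rank 4 · open · by planner
why it might fail: Standalone S is as hard as M: horizon-area convergence (MOTS second law under Q: monotone, bounded) gives S⇔M, so S fails exactly by eternal constant-area drift of (M,a); the torque plan misses energy-free channels (static tidal torque J̇∼M⁵χ|ℰ|², Ṁ higher order; zero-frequency exchange), no rate.
sources: TeukolskyPress1974, DafermosRodnianskiShlapentokhrothman2014, arXiv:gr-qc/0407050, AshtekarKrishnan2004, AnderssonMarsSimon2008, AnderssonMarsMetzgerSimon2009
[crux] (card K3 — CAPTURE FILTERS SPECIFIC ANGULAR MOMENTUM; rev 14: hypotheses re-synced to Q′, the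
block of MassFreezing verbatim) under Q′: each spin label converges, ∃ aᵢ∞, aᵢ(τ) → aᵢ∞ (the axis is
fixed by the boosted Kerr–Schild chart; aᵢ is the signed spin along it). Proof plan: the angular
momentum entering hole i after hole time τ is ≤ C(χ)Mᵢ × (energy incident after τ) + summable tidal
torque, the incident energy → 0 by the receding-sphere budget of MassFreezing, the filter constant
from TorqueFilterFixedFrequency / NullCaptureCone; J_ADM is never used (it is undefined on the
admissible class). [deps: MassFreezing, TorqueFilterFixedFrequency] [difficulty: XL] -/
@[route_item "route-FinalStateConjecture-RecedingSphereBudgets", crux]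
def SpinFreezing : Prop :=
  open Literature.Geometry.Lorentzian Summit.FinalStateConjecture in ∀ (X : Type) [TopologicalSpace X] [ChartedSpace E3 X] [IsManifold (𝓡 3) (⊤ : ℕ∞) X] [T2Space X] [SecondCountableTopology X] [ConnectedSpace X], ∀ D ∈ admissibleVacuumData X, ∀ 𝒟 : VacuumCauchyDevelopment D, 𝒟.IsMaximal → HasCompleteNullInfinity 𝒟.toCauchyDevelopment → ∀ (N : ℕ) (m₀ χ τ₀ δ₀ : ℝ) (M a : Fin N → ℝ → ℝ) (motion : Fin N → lorentzGroup × E4) (U : Fin N → Opens E4) (Ψ : ∀ i, U i → 𝒟.carrier) (ρ : Fin N → ℝ → ℝ) (U₀ : Opens E4) (Ψ₀ : U₀ → 𝒟.carrier) (O : Set 𝒟.carrier), (let S := 𝒟.toSpacetime; let 𝒞 := 𝒟.toCauchyDevelopment; let J := 𝒟.metric.causalPast 𝒟.timeOrientation; let L := fun i ↦ ((motion i).1 : E4 ≃L[ℝ] E4); let p := fun i ↦ poincareInv (motion i).1 (motion i).2; let e := fun i ↦ L i (E4.basisVector 0); let B : Fin N → ModelBackground := fun i ↦ ⟨U i, fun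 x ↦ boostedKerrBilin (motion i).1 (motion i).2 (M i (p i x 0)) (a i (p i x 0)) x, fun x ↦ p i x 0, fun x ↦ Kerr.radius (a i (p i x 0)) (p i x)⟩; let ξ := fun i (t : ℝ) ↦ E4.spatial (((t - (motion i).2 0) / e i 0) • e i + (motion i).2); let B₀ := Minkowski.backgroundOn U₀; let h := S.deviationExtend B₀ Ψ₀; let ext := fun i ↦ (B i).lateRegion τ₀ ∩ {x | Kerr.rPlus (M i (p i x.1 0)) (a i (p i x.1 0)) < (B i).radius x.1}; (0 < m₀ ∧ 0 ≤ χ ∧ χ < 1 ∧ 0 < δ₀ ∧ 2 * δ₀ < m₀) ∧ (∀ i, ContDiff ℝ (⊤ : ℕ∞) (M i) ∧ ContDiff ℝ (⊤ : ℕ∞) (a i) ∧ (∀ t, m₀ ≤ M i t ∧ M i t ≤ m₀⁻¹ ∧ |a i t| ≤ χ * M i t) ∧ ∀ n : ℕ, 1 ≤ n → Tendsto (iteratedDeriv n (M i)) atTop (𝓝 0) ∧ Tendsto (iteratedDeriv n (a i)) atTop (𝓝 0)) ∧ (∀ i, 0 < e i 0) ∧ Function.Injective e ∧ (∀ i, (U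 i : Set E4) = p i ⁻¹' {y : E4 | Kerr.rPlus (M i (y 0)) (a i (y 0)) - δ₀ < Kerr.radius (a i (y 0)) y}) ∧ (∀ i, S.IsLateChart (B i) Set.univ τ₀ (Ψ i) ∧ Ψ i '' ext i ⊆ O) ∧ (∀ i (k : ℕ) (R : ℝ), Tendsto (S.truncDeviationCk (B i) (Ψ i) k R) atTop (𝓝 0)) ∧ (∀ R : ℝ, ∃ τ₁, Pairwise (Disjoint on fun i ↦ Ψ i '' (B i).truncLateRegion τ₁ R)) ∧ (∀ i, Tendsto (fun t ↦ ρ i t / t) atTop (𝓝 0)) ∧ {x : E4 | τ₀ < x 0 ∧ ∀ i, ρ i (x 0) < E4.spatialNorm (p i x)} ⊆ ↑U₀ ∧ S.IsLateChart B₀ O τ₀ Ψ₀ ∧ Tendsto (S.deviationCk B₀ Ψ₀ 2) atTop (𝓝 0) ∧ O = exteriorOf 𝒞 (Ψ₀ '' B₀.lateRegion τ₀ ∪ ⋃ i, Ψ i '' ext i) ∧ (∀ τ₁ ≥ τ₀, RaysStayInClosure 𝒞 (exteriorOf 𝒞 (Ψ₀ '' B₀.lateRegion τ₁))) ∧ (∀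 i (ϱ : ℝ), ∀ᶠ τ in atTop, ∀ x ∈ (B i).truncTimeSlab ϱ τ, 𝒟.timeOrientation.IsFutureDirected (mfderiv 𝓘(ℝ, E4) (𝓡 4) (Ψ i) x (L i (Kerr.timeVector (M i (p i x.1 0)) (a i (p i x.1 0)) (p i x.1))))) ∧ (∀ᶠ τ in atTop, ∀ x ∈ B₀.timeSlab τ, 𝒟.timeOrientation.IsFutureDirected (mfderiv 𝓘(ℝ, E4) (𝓡 4) Ψ₀ x (E4.basisVector 0))) ∧ O \ ((⋃ i, Ψ i '' (B i).lateRegion τ₀) ∪ Ψ₀ '' B₀.lateRegion τ₀) ⊆ J ((⋃ i, Ψ i '' (B i).timeSlab τ₀) ∪ Ψ₀ '' B₀.timeSlab τ₀) ∧ (∃ C₁ C₂ : ℝ, ∀ i (x : U i) (y : U₀), τ₀ < (B i).time x.1 → Ψ i x = Ψ₀ y → ‖E4.spatial y.1 - ξ i (y.1 0)‖ ≤ C₂ * (B i).radius x.1 + C₁) ∧ (∃ C_W : ℝ, ∀ᶠ τ in atTop, ∀ x : U₀, x.1 0 = τ → let w := 1 + ⨅ i, ‖E4.spatial x.1 - ξ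 i τ‖; w ^ (9 / 10 : ℝ) * ‖h x.1‖ ≤ C_W ∧ ∀ m : ℕ, 1 ≤ m → m ≤ 2 → w * ‖iteratedFDeriv ℝ m h x.1‖ ≤ C_W) ∧ (∃ C_E : ℝ, ∀ᶠ τ in atTop, ∫⁻ y in {y : E3 | E4.ofTimeSpace τ y ∈ U₀}, ‖iteratedFDeriv ℝ 1 h (E4.ofTimeSpace τ y)‖ₑ ^ 2 ≤ ENNReal.ofReal C_E) ∧ ∃ R : Fin N → ℝ → ℝ, (∀ i, Tendsto (fun τ ↦ S.truncDeviationCk (B i) (Ψ i) 2 (R i τ) τ) atTop (𝓝 0)) ∧ ∀ τ₁ > τ₀, O \ (Ψ₀ '' B₀.lateRegion τ₁ ∪ ⋃ i, Ψ i '' {x | τ₁ < (B i).time x.1 ∧ (B i).radius x.1 ≤ R i ((B i).time x.1)}) ⊆ J (Ψ₀ '' B₀.timeSlab τ₁ ∪ ⋃ i, Ψ i '' (B i).truncTimeSlab (R i τ₁) τ₁)) → ∀ i, ∃ ai : ℝ, Tendsto (a i) atTop (𝓝 ai)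

-- earlier TorqueFilterFixedFrequency (stmt-FinalStateConjecture-14739, replaced 2026-08-15T20:07:55Z -> stmt-FinalStateConjecture-13875): retired by None — open Literature.Geometry.Lorentzian in ∀ χ : ℝ, 0 ≤ χ → χ < 1 → ∃ C : ℝ, ∀ (M a ω Λ T2 S r₀ : ℝ) (m : ℤ) (u : ℝ → ℂ), 0 < M → |a| ≤ χ * M → ω ≠ 0 → Kerr.IsAdmissibleTriple a ω m Λ → (∀ r, Kerr.rPlus M a < r → DifferentiableAt ℝ u r ∧ Differentiab
/-- item stmt-FinalStateConjecture-13875 · crux · rank 5 · open · by planner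
why it might fail: Via the Wronskian it reads |1−ℛ(ω,m,Λ)| ≤ C·M|ω|/|m|, ℛ=|A_out/A_in|², uniformly in ω, m, ADMISSIBLE Λ: no bound of this shape is in print (DRSR-III, SR–TdC control energy-weighted ℛ,T, not the |m|/ω weight); floor Λ=|m|(|m|+1) is ∼a²ω² below true eigenvalues (cone wider than 7M); C(χ) may →∞ as χ→1
sources: DafermosRodnianskiShlapentokhrothman2014, arXiv:1412.8379, ShlapentokhRothman2015ModeStability, TeukolskyPress1974, BardeenPressTeukolsky1972, arXiv:1501.06570
[crux] (card's Fastest refutation, typed; rev-2 text = rev-1 text with definitions written out) for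
every χ < 1 there is C such that for all sub-extremal Kerr (M, a), |a| ≤ χM, all real ω ≠ 0, m ∈ ℤ
and admissible Λ (DRSR Def. 6.1.1 written out: Λ ≥ |m|(|m|+1), Λ ≥ 2|amω|; =
`Kerr.IsAdmissibleTriple`), every solution u of Carter's radial ODE (Δ/(r²+a²)) d/dr((Δ/(r²+a²))
du/dr) + (ω² − V)u = 0 on r > r₊, Δ = r² − 2Mr + a², with V the DRSR separated potential in its
printed closed form V = (4Mramω − a²m² + ΔΛ)/(r²+a²)² + (Δ(3r² − 4Mr + a²)/(r²+a²)³ −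
3Δ²r²/(r²+a²)⁴) (DRSR Prop. 5.2.1, display following; = `Kerr.sepPotential`, cf. `sepPotential_eq`
of Literature/Geometry/Lorentzian/KerrSeparatedPotential.lean) and ω₊ = a/(2Mr₊) (=
`Kerr.horizonAngularVelocity`), which is INGOING at the horizon (|u|² → T2 as r ↓ r₊ and conserved
current Im(ū u_{r*}) = −(ω − mω₊)T2 at some r₀ > r₊) and has free asymptotics at infinity
((|u_{r*}|² + ω²|u|²)/(2ω²) → S = |A_in|² + |A_out|²), satisfies |m|·|ω − mω₊|·T2 ≤ C·M·ω²·|A_in|²,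
|A_in|² = (S + (ω − mω₊)T2/ω)/2: the angular momentum absorbed through 𝓗⁺ per unit INCIDENT energy
is at most C(χ)M, superradiant amplification included. Cone repair 2026-08 -/
@[route_item "route-FinalStateConjecture-RecedingSphereBudgets"]
def TorqueFilterFixedFrequency : Prop :=
  open Literature.Geometry.Lorentzian in ∀ χ : ℝ, 0 ≤ χ → χ < 1 → ∃ C : ℝ, ∀ (M a ω Λ T2 S r₀ : ℝ) (m : ℤ) (u : ℝ → ℂ), (let Δ : ℝ → ℝ := fun r ↦ r ^ 2 - 2 * M * r + a ^ 2; let V : ℝ → ℝ := fun r ↦ (4 * M * r * a * m * ω - a ^ 2 * (m : ℝ) ^ 2 + Δ r * Λ) / (r ^ 2 + a ^ 2) ^ 2 + (Δ r * (3 * r ^ 2 - 4 * M * r + a ^ 2) / (r ^ 2 + a ^ 2) ^ 3 - 3 * Δ r ^ 2 * r ^ 2 / (r ^ 2 + a ^ 2) ^ 4); let ωH : ℝ := a / (2 * M * Kerr.rPlus M a); let f : ℝ → ℂ := fun r ↦ ((Δ r / (r ^ 2 + a ^ 2) : ℝ) : ℂ); 0 < M → |a| ≤ χ * M → ω ≠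 0 → (|(m : ℝ)| * (|(m : ℝ)| + 1) ≤ Λ ∧ 2 * |a * m * ω| ≤ Λ) → (∀ r, Kerr.rPlus M a < r → DifferentiableAt ℝ u r ∧ DifferentiableAt ℝ (fun s ↦ f s * deriv u s) r) → (∀ r, Kerr.rPlus M a < r → f r * deriv (fun s ↦ f s * deriv u s) r + ((ω ^ 2 - V r : ℝ) : ℂ) * u r = 0) → Tendsto (fun r ↦ ‖u r‖ ^ 2) (𝓝[>] (Kerr.rPlus M a)) (𝓝 T2) → Tendsto (fun r ↦ (‖f r * deriv u r‖ ^ 2 + ω ^ 2 * ‖u r‖ ^ 2) / (2 * ω ^ 2)) atTop (𝓝 S) → Kerr.rPlus M a < r₀ → (starRingEnd ℂ (u r₀) * (f r₀ * deriv u r₀)).im = -(ω - m * ωH) * T2 → |(m : ℝ)| * |ω - m * ωH| * T2 ≤ C * M * ω ^ 2 * ((S + (ω - m * ωH) * T2 / ω) / 2))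

-- earlier RecedingEnergyAlmostMonotone (stmt-FinalStateConjecture-13656, replaced 2026-08-16T03:41:42Z -> stmt-FinalStateConjecture-14532): retired by None — [crux] (card K1, first child of the foreseen split of MassFreezing) In the setting of Q (the hypothesis block of MassFreezing: vacuum MGHD of an admissible datum with complete scri+, shape-settled final era with drifting adiabatic labels, flat 
-- earlier RecedingEnergyAlmostMonotone (stmt-FinalStateConjecture-14532, replaced 2026-08-16T23:27:16Z -> stmt-FinalStateConjecture-17688): retired by None — open Literature.Geometry.Lorentzian in ∀ (X : Type) [TopologicalSpace X] [ChartedSpace E3 X] [IsManifold (𝓡 3) ((⊤ : ℕ∞) : WithTop ℕ∞) X] [T2Space X] [SecondCountableTopology X] [ConnectedSpace X], ∀ D ∈ admissibleVacuumData X, ∀ 𝒟 : VacuumCauc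
/-- item stmt-FinalStateConjecture-17688 · crux · rank 6 · open · by planner
why it might fail: W kills co-moving corrugations only: residual □ζ=0 gauge waves must be tamed by the slab energy; ∮∂h dS over area ~t² is O(t) a priori (bounded below is claimed, not given); no clause makes the influx through Sᵢ (tails, drizzle, own backscatter) L¹; Q∧W may clash near the null cone (log terms).
sources: doi:10.1007/s00220-002-0723-2, arXiv:math/0112071, arXiv:1504.01595, arXiv:1210.7953, LandauLifshitz1975, Blanchet2024
[crux] (card K1, first child of the foreseen split of MassFreezing; typed at rev 8 — repair after
refuted-misstated 2026-08-16, refuter rattack-13656-0, Evidence13656.md) In the setting of Q′ (rev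
14: the hypothesis block of MassFreezing, copied verbatim — C′ exterior-only O, smooth labels, all-k
collar convergence, rays/orientation clauses, honest radii; admissible datum, vacuum MGHD with
complete 𝓘⁺, shape-settled final era with drifting adiabatic labels, flat chart Ψ₀ on U₀ with
wave-zone weights and finite slab energy, chart worldlines ξⱼ with 4-velocities eⱼ) AND the
wave-coordinate clause W: the flat chart is harmonic on the late far region, ∂_μ 𝔤^{μν}(η + h) = 0
at every x ∈ U₀ with τ₀ < x⁰ (⇔ □_g x^ν = 0, de Donder; `LandauLifshitz.gothic`,
`LandauLifshitz.partialDeriv`), fix a hole i and a speed β with 0 < β, ‖vᵢ‖ + β < 1 and 2β < ‖vᵢ −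
vⱼ‖ for every j ≠ i (vⱼ := spatial(eⱼ)/eⱼ⁰; typed ∀ j ≠ i, so N = 1 is allowed). Let Eᵢ(t) := the
Landau–Lifshitz quasi-local energy P⁰(t, ξᵢ(t), βt) of g₀ = η + h on the coordinate sphere {x⁰ = t,
|x̲ − ξᵢ(t)| = βt} (`LandauLifshitz.quasiLocalMomentum … 0`, LL (96.16)) — ONE functional: the
Hawking-mass reading of the informal K1 is withdr -/
@[route_item "route-FinalStateConjecture-RecedingSphereBudgets"]
def RecedingEnergyAlmostMonotone : Prop :=
  open Literature.Geometry.Lorentzian Summit.FinalStateConjecture LandauLifshitz in ∀ (X : Type) [TopologicalSpace X] [ChartedSpace E3 X] [IsManifold (𝓡 3) (⊤ : ℕ∞) X] [T2Space X] [SecondCountableTopology X] [ConnectedSpace X], ∀ D ∈ admissibleVacuumData X, ∀ 𝒟 : VacuumCauchyDevelopment D, 𝒟.IsMaximal → HasCompleteNullInfinity 𝒟.toCauchyDevelopment → ∀ (N : ℕ) (m₀ χ τ₀ δ₀ : ℝ) (M a : Fin N → ℝ → ℝ) (motion : Fin N → lorentzGroup × E4) (U : Fin N → Opens E4) (Ψ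 : ∀ i, U i → 𝒟.carrier) (ρ : Fin N → ℝ → ℝ) (U₀ : Opens E4) (Ψ₀ : U₀ → 𝒟.carrier) (O : Set 𝒟.carrier), (let S := 𝒟.toSpacetime; let 𝒞 := 𝒟.toCauchyDevelopment; let J := 𝒟.metric.causalPast 𝒟.timeOrientation; let L := fun i ↦ ((motion i).1 : E4 ≃L[ℝ] E4); let p := fun i ↦ poincareInv (motion i).1 (motion i).2; let e := fun i ↦ L i (E4.basisVector 0); let B : Fin N → ModelBackground := fun i ↦ ⟨U i, fun x ↦ boostedKerrBilin (motion i).1 (motion i).2 (M i (p i x 0)) (a i (p i x 0)) x, fun x ↦ p i x 0, fun x ↦ Kerr.radius (a i (p i x 0)) (p i x)⟩; let ξ := fun i (t : ℝ) ↦ E4.spatial (((t - (motion i).2 0) / e i 0) • e i + (motion i).2); let B₀ := Minkowski.backgroundOn U₀; let h := S.deviationExtend B₀ Ψ₀; let ext := fun i ↦ (B i).lateRegion τ₀ ∩ {x | Kerr.rPlus (M i (p i x.1 0)) (a i (p i x.1 0)) < (B i).radius x.1}; let v := fun j ↦ (e j 0)⁻¹ • E4.spatial (e j); let g₀ := fun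 z ↦ Minkowski.bilin + h z; ((0 < m₀ ∧ 0 ≤ χ ∧ χ < 1 ∧ 0 < δ₀ ∧ 2 * δ₀ < m₀) ∧ (∀ i, ContDiff ℝ (⊤ : ℕ∞) (M i) ∧ ContDiff ℝ (⊤ : ℕ∞) (a i) ∧ (∀ t, m₀ ≤ M i t ∧ M i t ≤ m₀⁻¹ ∧ |a i t| ≤ χ * M i t) ∧ ∀ n : ℕ, 1 ≤ n → Tendsto (iteratedDeriv n (M i)) atTop (𝓝 0) ∧ Tendsto (iteratedDeriv n (a i)) atTop (𝓝 0)) ∧ (∀ i, 0 < e i 0) ∧ Function.Injective e ∧ (∀ i, (U i : Set E4) = p i ⁻¹' {y : E4 | Kerr.rPlus (M i (y 0)) (a i (y 0)) - δ₀ < Kerr.radius (a i (y 0)) y}) ∧ (∀ i, S.IsLateChart (B i) Set.univ τ₀ (Ψ i) ∧ Ψ i '' ext i ⊆ O) ∧ (∀ i (k : ℕ) (R : ℝ), Tendsto (S.truncDeviationCk (B i) (Ψ i) k R) atTop (𝓝 0)) ∧ (∀ R : ℝ, ∃ τ₁, Pairwise (Disjoint on fun i ↦ Ψ i '' (B i).truncLateRegion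 τ₁ R)) ∧ (∀ i, Tendsto (fun t ↦ ρ i t / t) atTop (𝓝 0)) ∧ {x : E4 | τ₀ < x 0 ∧ ∀ i, ρ i (x 0) < E4.spatialNorm (p i x)} ⊆ ↑U₀ ∧ S.IsLateChart B₀ O τ₀ Ψ₀ ∧ Tendsto (S.deviationCk B₀ Ψ₀ 2) atTop (𝓝 0) ∧ O = exteriorOf 𝒞 (Ψ₀ '' B₀.lateRegion τ₀ ∪ ⋃ i, Ψ i '' ext i) ∧ (∀ τ₁ ≥ τ₀, RaysStayInClosure 𝒞 (exteriorOf 𝒞 (Ψ₀ '' B₀.lateRegion τ₁))) ∧ (∀ i (ϱ : ℝ), ∀ᶠ τ in atTop, ∀ x ∈ (B i).truncTimeSlab ϱ τ, 𝒟.timeOrientation.IsFutureDirected (mfderiv 𝓘(ℝ, E4) (𝓡 4) (Ψ i) x (L i (Kerr.timeVector (M i (p i x.1 0)) (a i (p i x.1 0)) (p i x.1))))) ∧ (∀ᶠ τ in atTop, ∀ x ∈ B₀.timeSlab τ, 𝒟.timeOrientation.IsFutureDirected (mfderiv 𝓘(ℝ, E4) (𝓡 4) Ψ₀ x (E4.basisVector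 0))) ∧ O \ ((⋃ i, Ψ i '' (B i).lateRegion τ₀) ∪ Ψ₀ '' B₀.lateRegion τ₀) ⊆ J ((⋃ i, Ψ i '' (B i).timeSlab τ₀) ∪ Ψ₀ '' B₀.timeSlab τ₀) ∧ (∃ C₁ C₂ : ℝ, ∀ i (x : U i) (y : U₀), τ₀ < (B i).time x.1 → Ψ i x = Ψ₀ y → ‖E4.spatial y.1 - ξ i (y.1 0)‖ ≤ C₂ * (B i).radius x.1 + C₁) ∧ (∃ C_W : ℝ, ∀ᶠ τ in atTop, ∀ x : U₀, x.1 0 = τ → let w := 1 + ⨅ i, ‖E4.spatial x.1 - ξ i τ‖; w ^ (9 / 10 : ℝ) * ‖h x.1‖ ≤ C_W ∧ ∀ m : ℕ, 1 ≤ m → m ≤ 2 → w * ‖iteratedFDeriv ℝ m h x.1‖ ≤ C_W) ∧ (∃ C_E : ℝ, ∀ᶠ τ in atTop, ∫⁻ y in {y : E3 | E4.ofTimeSpace τ y ∈ U₀}, ‖iteratedFDeriv ℝ 1 h (E4.ofTimeSpace τ y)‖ₑ ^ 2 ≤ ENNReal.ofReal C_E) ∧ ∃ R : Fin N → ℝ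 → ℝ, (∀ i, Tendsto (fun τ ↦ S.truncDeviationCk (B i) (Ψ i) 2 (R i τ) τ) atTop (𝓝 0)) ∧ ∀ τ₁ > τ₀, O \ (Ψ₀ '' B₀.lateRegion τ₁ ∪ ⋃ i, Ψ i '' {x | τ₁ < (B i).time x.1 ∧ (B i).radius x.1 ≤ R i ((B i).time x.1)}) ⊆ J (Ψ₀ '' B₀.timeSlab τ₁ ∪ ⋃ i, Ψ i '' (B i).truncTimeSlab (R i τ₁) τ₁)) → (∀ x : U₀, τ₀ < x.1 0 → ∀ ν : Fin 4, ∑ μ : Fin 4, partialDeriv μ (fun y ↦ gothic g₀ y μ ν) x.1 = 0) → ∀ i (β : ℝ), 0 < β → ‖v i‖ + β < 1 → (∀ j, j ≠ i → 2 * β < ‖v i - v j‖) → let Ei := fun t : ℝ ↦ quasiLocalMomentum g₀ t (ξ i t) (β * t) 0; ∃ (F : ℝ → ℝ) (T b : ℝ), Tendsto F atTop (𝓝 0) ∧ (∀ t ≥ T, b ≤ Ei t) ∧ ∀ t₁ ≥ T, ∀ t₂ ≥ t₁, Ei t₂ ≤ Ei t₁ + F t₁)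

-- earlier RecedingEnergyIdentification (stmt-FinalStateConjecture-13657, replaced 2026-08-16T03:58:11Z -> stmt-FinalStateConjecture-14577): retired by None — [crux] (card K2, second child of the foreseen split of MassFreezing) Same setting and notation as RecedingEnergyAlmostMonotone. CLAIM: (a) no energy stays in flight inside the receding sphere: for any two admissible speeds β < β′, P⁰(t, ξᵢ(t), 
-- earlier RecedingEnergyIdentification (stmt-FinalStateConjecture-14577, replaced 2026-08-16T23:27:16Z -> stmt-FinalStateConjecture-17689): retired by None — open Literature.Geometry.Lorentzian in ∀ (X : Type) [TopologicalSpace X] [ChartedSpace E3 X] [IsManifold (𝓡 3) ((⊤ : ℕ∞) : WithTop ℕ∞) X] [T2Space X] [SecondCountableTopology X] [ConnectedSpace X], ∀ D ∈ admissibleVacuumData X, ∀ 𝒟 : VacuumCauc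
/-- item stmt-FinalStateConjecture-17689 · crux · rank 7 · open · by planner
why it might fail: Wave gauge kills the O(r) linear flux and corrugations, but (1+d)^{9/10}|h| lets residual gauge/tail amplitudes grow like u^{1/10}, u=(1−β)t; the label↔sphere bridge crosses the uncertified gap ρᵢ<|x|, r>Rᵢ(τ) (KS↔harmonic); central clock presumes labels vary o(1) on [ct,t] (Ṁ→0 allows sin∘log).
sources: LandauLifshitz1975, arXiv:gr-qc/9501002, doi:10.1063/1.522480 (Gürses–Gürsey 1975, J. Math. Phys. 16, 2385), LindbladRodnianski2010Annals, arXiv:2109.08434, doi:10.1007/s00220-002-0723-2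
[crux] (card K2; REPAIRED and TYPED 2026-08-16 after refuted-misstated by rattack-13657-0,
rattack-13657-g2-0 and the sibling attack rattack-13656-0; foreseen 2nd split child of MassFreezing,
hypotheses IDENTICAL to the typed K1 = RecedingEnergyAlmostMonotone of rev 8) SETTING (rev 14: Q →
Q′ re-sync, otherwise unchanged): the hypothesis block Q′ of MassFreezing verbatim AND the
wave-coordinate clause W of K1 verbatim: the flat chart is harmonic on the late far region, Σ_μ ∂_μ
𝔤^{μν}(η + h)(x) = 0 for every x ∈ U₀ with τ₀ < x⁰, ν = 0..3 (de Donder, □_g x^ν = 0;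
`LandauLifshitz.gothic`, `LandauLifshitz.partialDeriv`; h = deviationExtend B₀ Ψ₀). This is the
missing normalisation the refuters named: the refuted text quantified over ALL Q-admissible flat
charts, and pure-gauge deformations of Ψ₀ preserving every clause of Q — co-moving tangential
wrinkle (ΔE = −(2/15)β²κ²k²FF′(0)), re-slicing wrinkle (+(1/6)β²κ²k²FF′(0)), radial corrugation
(κa₀², or no limit) — shift the LL energy of the receding coordinate sphere at O(1); all have □ζ ≠ 0
and violate W; residual gauge waves (□ζ = 0) move at speed 1, cross the sphere (β < 1) and have
square-summable amplitudes by the slab-energy clause -/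
@[route_item "route-FinalStateConjecture-RecedingSphereBudgets"]
def RecedingEnergyIdentification : Prop :=
  open Literature.Geometry.Lorentzian Summit.FinalStateConjecture LandauLifshitz in ∀ (X : Type) [TopologicalSpace X] [ChartedSpace E3 X] [IsManifold (𝓡 3) (⊤ : ℕ∞) X] [T2Space X] [SecondCountableTopology X] [ConnectedSpace X], ∀ D ∈ admissibleVacuumData X, ∀ 𝒟 : VacuumCauchyDevelopment D, 𝒟.IsMaximal → HasCompleteNullInfinity 𝒟.toCauchyDevelopment → ∀ (N : ℕ) (m₀ χ τ₀ δ₀ : ℝ) (M a : Fin N → ℝ → ℝ) (motion : Fin N → lorentzGroup × E4) (U : Fin N → Opens E4) (Ψ : ∀ i, U i → 𝒟.carrier) (ρ : Fin N → ℝ → ℝ) (U₀ : Opens E4) (Ψ₀ : U₀ → 𝒟.carrier) (O : Set 𝒟.carrier), (let S := 𝒟.toSpacetime; let 𝒞 := 𝒟.toCauchyDevelopment; let J := 𝒟.metric.causalPast 𝒟.timeOrientation; let L := fun i ↦ ((motion i).1 : E4 ≃L[ℝ] E4); let p := fun i ↦ poincareInv (motion i).1 (motion i).2; let e := fun i ↦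 L i (E4.basisVector 0); let B : Fin N → ModelBackground := fun i ↦ ⟨U i, fun x ↦ boostedKerrBilin (motion i).1 (motion i).2 (M i (p i x 0)) (a i (p i x 0)) x, fun x ↦ p i x 0, fun x ↦ Kerr.radius (a i (p i x 0)) (p i x)⟩; let ξ := fun i (t : ℝ) ↦ E4.spatial (((t - (motion i).2 0) / e i 0) • e i + (motion i).2); let B₀ := Minkowski.backgroundOn U₀; let h := S.deviationExtend B₀ Ψ₀; let ext := fun i ↦ (B i).lateRegion τ₀ ∩ {x | Kerr.rPlus (M i (p i x.1 0)) (a i (p i x.1 0)) < (B i).radius x.1}; let v := fun j ↦ (e j 0)⁻¹ • E4.spatial (e j); let g₀ := fun z ↦ Minkowski.bilin + h z; ((0 < m₀ ∧ 0 ≤ χ ∧ χ < 1 ∧ 0 < δ₀ ∧ 2 * δ₀ < m₀) ∧ (∀ i, ContDiff ℝ (⊤ : ℕ∞) (M i) ∧ ContDiff ℝ (⊤ : ℕ∞) (a i) ∧ (∀ t, m₀ ≤ M i t ∧ M i t ≤ m₀⁻¹ ∧ |a i t| ≤ χ * M i t) ∧ ∀ n : ℕ, 1 ≤ n → Tendsto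 (iteratedDeriv n (M i)) atTop (𝓝 0) ∧ Tendsto (iteratedDeriv n (a i)) atTop (𝓝 0)) ∧ (∀ i, 0 < e i 0) ∧ Function.Injective e ∧ (∀ i, (U i : Set E4) = p i ⁻¹' {y : E4 | Kerr.rPlus (M i (y 0)) (a i (y 0)) - δ₀ < Kerr.radius (a i (y 0)) y}) ∧ (∀ i, S.IsLateChart (B i) Set.univ τ₀ (Ψ i) ∧ Ψ i '' ext i ⊆ O) ∧ (∀ i (k : ℕ) (R : ℝ), Tendsto (S.truncDeviationCk (B i) (Ψ i) k R) atTop (𝓝 0)) ∧ (∀ R : ℝ, ∃ τ₁, Pairwise (Disjoint on fun i ↦ Ψ i '' (B i).truncLateRegion τ₁ R)) ∧ (∀ i, Tendsto (fun t ↦ ρ i t / t) atTop (𝓝 0)) ∧ {x : E4 | τ₀ < x 0 ∧ ∀ i, ρ i (x 0) < E4.spatialNorm (p i x)} ⊆ ↑U₀ ∧ S.IsLateChart B₀ O τ₀ Ψ₀ ∧ Tendsto (S.deviationCk B₀ Ψ₀ 2) atTop (𝓝 0) ∧ O = exteriorOf 𝒞 (Ψ₀ '' B₀.lateRegion τ₀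 ∪ ⋃ i, Ψ i '' ext i) ∧ (∀ τ₁ ≥ τ₀, RaysStayInClosure 𝒞 (exteriorOf 𝒞 (Ψ₀ '' B₀.lateRegion τ₁))) ∧ (∀ i (ϱ : ℝ), ∀ᶠ τ in atTop, ∀ x ∈ (B i).truncTimeSlab ϱ τ, 𝒟.timeOrientation.IsFutureDirected (mfderiv 𝓘(ℝ, E4) (𝓡 4) (Ψ i) x (L i (Kerr.timeVector (M i (p i x.1 0)) (a i (p i x.1 0)) (p i x.1))))) ∧ (∀ᶠ τ in atTop, ∀ x ∈ B₀.timeSlab τ, 𝒟.timeOrientation.IsFutureDirected (mfderiv 𝓘(ℝ, E4) (𝓡 4) Ψ₀ x (E4.basisVector 0))) ∧ O \ ((⋃ i, Ψ i '' (B i).lateRegion τ₀) ∪ Ψ₀ '' B₀.lateRegion τ₀) ⊆ J ((⋃ i, Ψ i '' (B i).timeSlab τ₀) ∪ Ψ₀ '' B₀.timeSlab τ₀) ∧ (∃ C₁ C₂ : ℝ, ∀ i (x : U i) (y : U₀), τ₀ < (B i).time x.1 → Ψ i x = Ψ₀ y → ‖E4.spatial y.1 - ξ i (y.1 0)‖ ≤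 C₂ * (B i).radius x.1 + C₁) ∧ (∃ C_W : ℝ, ∀ᶠ τ in atTop, ∀ x : U₀, x.1 0 = τ → let w := 1 + ⨅ i, ‖E4.spatial x.1 - ξ i τ‖; w ^ (9 / 10 : ℝ) * ‖h x.1‖ ≤ C_W ∧ ∀ m : ℕ, 1 ≤ m → m ≤ 2 → w * ‖iteratedFDeriv ℝ m h x.1‖ ≤ C_W) ∧ (∃ C_E : ℝ, ∀ᶠ τ in atTop, ∫⁻ y in {y : E3 | E4.ofTimeSpace τ y ∈ U₀}, ‖iteratedFDeriv ℝ 1 h (E4.ofTimeSpace τ y)‖ₑ ^ 2 ≤ ENNReal.ofReal C_E) ∧ ∃ R : Fin N → ℝ → ℝ, (∀ i, Tendsto (fun τ ↦ S.truncDeviationCk (B i) (Ψ i) 2 (R i τ) τ) atTop (𝓝 0)) ∧ ∀ τ₁ > τ₀, O \ (Ψ₀ '' B₀.lateRegion τ₁ ∪ ⋃ i, Ψ i '' {x | τ₁ < (B i).time x.1 ∧ (B i).radius x.1 ≤ R i ((B i).time x.1)}) ⊆ J (Ψ₀ '' B₀.timeSlab τ₁ ∪ ⋃ i, Ψ i ''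 (B i).truncTimeSlab (R i τ₁) τ₁)) → (∀ x : U₀, τ₀ < x.1 0 → ∀ ν : Fin 4, ∑ μ : Fin 4, partialDeriv μ (fun y ↦ gothic g₀ y μ ν) x.1 = 0) → ∀ i (β : ℝ), 0 < β → ‖v i‖ + β < 1 → (∀ j, j ≠ i → 2 * β < ‖v i - v j‖) → let Ei := fun t : ℝ ↦ quasiLocalMomentum g₀ t (ξ i t) (β * t) 0; Tendsto (fun t ↦ Ei t - e i 0 * M i ((t - (motion i).2 0) / e i 0)) atTop (𝓝 0))

-- earlier Reanchoring (stmt-FinalStateConjecture-14740, replaced 2026-08-16T23:27:16Z -> stmt-FinalStateConjecture-17690): retired by None — open Literature.Geometry.Lorentzian in ∀ (X : Type) [TopologicalSpace X] [ChartedSpace E3 X] [IsManifold (𝓡 3) ((⊤ : ℕ∞) : WithTop ℕ∞) X] [T2Space X] [SecondCountableTopology X] [ConnectedSpace X], ∀ D ∈ admissibleVacuumData X, ∀ 𝒟 : VacuumCauchyDevelopment D, 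
/-- item stmt-FinalStateConjecture-17690 · crux · rank 9 · open · by planner
why it might fail: Horizon normalisation is forced (accretion keeps 𝓗⁺ inside {r=r₊∞}; an uncovered d.o.c. sliver breaks exhaustiveness) and needs ∂O∩collar to be a C³-small graph: true in the expected picture, but from Q′ it is stable-manifold theory for null generators + near-Kerr causal bookkeeping, none in Lean.
sources: HawkingEllis1973, arXiv:gr-qc/0001003, arXiv:2104.08222, AshtekarKrishnan2004, arXiv:gr-qc/0508107, arXiv:0811.0354
[crux] (re-anchoring of the engine to the revised Statement; rev 14 conclusion = the Statement's
settling clause after re-type T2 p126844) for every admissible datum, every MGHD with complete 𝓘⁺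
and every Q′ (the block of MassFreezing verbatim): if every Mᵢ(τ) and every aᵢ(τ) converges then ∃
O′ ⊆ 𝒟 and a C² FinalStateDecomposition d of O′ with (∀ i, Kerr.IsSubextremal (d.mass i) (d.spin
i)), O′ = exteriorOf 𝒟 d.charted, RaysStayInClosure 𝒟 O′, HasExhaustiveCharts d (honest radii Rᵢ →
∞, Rᵢ ≥ max(r₊,0)+1) and IsFutureOriented d — verbatim the conjunction the Statement asks of every
MGHD. Construction: d.mass/spin = the limits (Mᵢ∞, aᵢ∞) (sub-extremal: |aᵢ∞| ≤ χMᵢ∞ < Mᵢ∞, Mᵢ∞ ≥ m₀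
> 0), d.motion = motion, d.flatDomain = U₀, d.flatChart = Ψ₀, d.excision = ρ (Kerr.radius ≤ spatial
norm), d.τ₀ = a late τ₀′ ≥ τ₀; then O′ ⊇ exteriorOf 𝒟 (Ψ₀ '' {x⁰ > τ₀′}) and Q′'s rays clause at τ₁
= τ₀′ gives RaysStayInClosure by monotonicity of closure; IsFutureOriented (i) is Q′'s 0 < (Λᵢe₀)⁰
(IsOrthochronous by Iff.rfl), (iii) is Q′'s flat clause; d.chart i = Ψᵢ ∘ Φᵢ with Φᵢ the radial
graph map of the frozen exterior {r > r₊(Mᵢ∞,aᵢ∞)} onto the part of the collar chart outside 𝓗⁺ = ∂O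
∩ (collar image -/
@[route_item "route-FinalStateConjecture-RecedingSphereBudgets", crux]
def Reanchoring : Prop :=
  open Literature.Geometry.Lorentzian Summit.FinalStateConjecture in ∀ (X : Type) [TopologicalSpace X] [ChartedSpace E3 X] [IsManifold (𝓡 3) (⊤ : ℕ∞) X] [T2Space X] [SecondCountableTopology X] [ConnectedSpace X], ∀ D ∈ admissibleVacuumData X, ∀ 𝒟 : VacuumCauchyDevelopment D, 𝒟.IsMaximal → HasCompleteNullInfinity 𝒟.toCauchyDevelopment → ∀ (N : ℕ) (m₀ χ τ₀ δ₀ : ℝ) (M a : Fin N → ℝ → ℝ) (motion : Fin N → lorentzGroup × E4) (U : Fin N → Opens E4) (Ψ : ∀ i, U i → 𝒟.carrier) (ρ : Fin N → ℝ → ℝ) (U₀ : Opens E4) (Ψ₀ : U₀ → 𝒟.carrier) (O : Set 𝒟.carrier), (let S := 𝒟.toSpacetime; let 𝒞 := 𝒟.toCauchyDevelopment; let J := 𝒟.metric.causalPast 𝒟.timeOrientation; let L := fun i ↦ ((motion i).1 : E4 ≃L[ℝ] E4); let p := fun i ↦ poincareInv (motion i).1 (motion i).2; let e := fun i ↦ L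 i (E4.basisVector 0); let B : Fin N → ModelBackground := fun i ↦ ⟨U i, fun x ↦ boostedKerrBilin (motion i).1 (motion i).2 (M i (p i x 0)) (a i (p i x 0)) x, fun x ↦ p i x 0, fun x ↦ Kerr.radius (a i (p i x 0)) (p i x)⟩; let ξ := fun i (t : ℝ) ↦ E4.spatial (((t - (motion i).2 0) / e i 0) • e i + (motion i).2); let B₀ := Minkowski.backgroundOn U₀; let h := S.deviationExtend B₀ Ψ₀; let ext := fun i ↦ (B i).lateRegion τ₀ ∩ {x | Kerr.rPlus (M i (p i x.1 0)) (a i (p i x.1 0)) < (B i).radius x.1}; (0 < m₀ ∧ 0 ≤ χ ∧ χ < 1 ∧ 0 < δ₀ ∧ 2 * δ₀ < m₀) ∧ (∀ i, ContDiff ℝ (⊤ : ℕ∞) (M i) ∧ ContDiff ℝ (⊤ : ℕ∞) (a i) ∧ (∀ t, m₀ ≤ M i t ∧ M i t ≤ m₀⁻¹ ∧ |a i t| ≤ χ * M i t) ∧ ∀ n : ℕ, 1 ≤ n → Tendsto (iteratedDeriv n (M i)) atTop (𝓝 0) ∧ Tendsto (iteratedDeriv n (a i)) atTop (𝓝 0))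 ∧ (∀ i, 0 < e i 0) ∧ Function.Injective e ∧ (∀ i, (U i : Set E4) = p i ⁻¹' {y : E4 | Kerr.rPlus (M i (y 0)) (a i (y 0)) - δ₀ < Kerr.radius (a i (y 0)) y}) ∧ (∀ i, S.IsLateChart (B i) Set.univ τ₀ (Ψ i) ∧ Ψ i '' ext i ⊆ O) ∧ (∀ i (k : ℕ) (R : ℝ), Tendsto (S.truncDeviationCk (B i) (Ψ i) k R) atTop (𝓝 0)) ∧ (∀ R : ℝ, ∃ τ₁, Pairwise (Disjoint on fun i ↦ Ψ i '' (B i).truncLateRegion τ₁ R)) ∧ (∀ i, Tendsto (fun t ↦ ρ i t / t) atTop (𝓝 0)) ∧ {x : E4 | τ₀ < x 0 ∧ ∀ i, ρ i (x 0) < E4.spatialNorm (p i x)} ⊆ ↑U₀ ∧ S.IsLateChart B₀ O τ₀ Ψ₀ ∧ Tendsto (S.deviationCk B₀ Ψ₀ 2) atTop (𝓝 0) ∧ O = exteriorOf 𝒞 (Ψ₀ '' B₀.lateRegion τ₀ ∪ ⋃ i, Ψ i '' ext i) ∧ (∀ τ₁ ≥ τ₀, RaysStayInClosure 𝒞 (exteriorOf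 𝒞 (Ψ₀ '' B₀.lateRegion τ₁))) ∧ (∀ i (ϱ : ℝ), ∀ᶠ τ in atTop, ∀ x ∈ (B i).truncTimeSlab ϱ τ, 𝒟.timeOrientation.IsFutureDirected (mfderiv 𝓘(ℝ, E4) (𝓡 4) (Ψ i) x (L i (Kerr.timeVector (M i (p i x.1 0)) (a i (p i x.1 0)) (p i x.1))))) ∧ (∀ᶠ τ in atTop, ∀ x ∈ B₀.timeSlab τ, 𝒟.timeOrientation.IsFutureDirected (mfderiv 𝓘(ℝ, E4) (𝓡 4) Ψ₀ x (E4.basisVector 0))) ∧ O \ ((⋃ i, Ψ i '' (B i).lateRegion τ₀) ∪ Ψ₀ '' B₀.lateRegion τ₀) ⊆ J ((⋃ i, Ψ i '' (B i).timeSlab τ₀) ∪ Ψ₀ '' B₀.timeSlab τ₀) ∧ (∃ C₁ C₂ : ℝ, ∀ i (x : U i) (y : U₀), τ₀ < (B i).time x.1 → Ψ i x = Ψ₀ y → ‖E4.spatial y.1 - ξ i (y.1 0)‖ ≤ C₂ * (B i).radius x.1 + C₁) ∧ (∃ C_W : ℝ, ∀ᶠ τ in atTop, ∀ x : U₀, x.1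 0 = τ → let w := 1 + ⨅ i, ‖E4.spatial x.1 - ξ i τ‖; w ^ (9 / 10 : ℝ) * ‖h x.1‖ ≤ C_W ∧ ∀ m : ℕ, 1 ≤ m → m ≤ 2 → w * ‖iteratedFDeriv ℝ m h x.1‖ ≤ C_W) ∧ (∃ C_E : ℝ, ∀ᶠ τ in atTop, ∫⁻ y in {y : E3 | E4.ofTimeSpace τ y ∈ U₀}, ‖iteratedFDeriv ℝ 1 h (E4.ofTimeSpace τ y)‖ₑ ^ 2 ≤ ENNReal.ofReal C_E) ∧ ∃ R : Fin N → ℝ → ℝ, (∀ i, Tendsto (fun τ ↦ S.truncDeviationCk (B i) (Ψ i) 2 (R i τ) τ) atTop (𝓝 0)) ∧ ∀ τ₁ > τ₀, O \ (Ψ₀ '' B₀.lateRegion τ₁ ∪ ⋃ i, Ψ i '' {x | τ₁ < (B i).time x.1 ∧ (B i).radius x.1 ≤ R i ((B i).time x.1)}) ⊆ J (Ψ₀ '' B₀.timeSlab τ₁ ∪ ⋃ i, Ψ i '' (B i).truncTimeSlab (R i τ₁) τ₁)) → (∀ i, ∃ Mi : ℝ, Tendsto (M i) atTop (𝓝 Mi))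 → (∀ i, ∃ ai : ℝ, Tendsto (a i) atTop (𝓝 ai)) → ∃ (O' : Set 𝒟.carrier) (d : FinalStateDecomposition 𝒟.toSpacetime O' 2), (∀ i, Kerr.IsSubextremal (d.mass i) (d.spin i)) ∧ O' = exteriorOf 𝒟.toCauchyDevelopment d.charted ∧ RaysStayInClosure 𝒟.toCauchyDevelopment O' ∧ HasExhaustiveCharts d ∧ IsFutureOriented d

-- earlier NullCaptureCone (stmt-FinalStateConjecture-14741, replaced 2026-08-15T20:10:58Z -> stmt-FinalStateConjecture-13678): retired by None — open Literature.Geometry.Lorentzian in ∀ (M a E L Q : ℝ), 0 < M → |a| < M → 0 < E → 0 ≤ Q → 7 * M * E ≤ |L| → ∃ r : ℝ, Kerr.rPlus M a < r ∧ (E * (r ^ 2 + a ^ 2) - a * L) ^ 2 - Kerr.delta M a r * ((L - a * E) ^ 2 + Q) ≤ 0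
/-- item stmt-FinalStateConjecture-13678 · support · rank 9 · closed · proved by Summit.FinalStateConjecture.FinalStateConjecture.Theorems.NullCaptureCone_proof @ d0c8d461ed3e (prover) · by planner
sources: Bardeen1973, doi:10.1023/A:1026286607562, Chandrasekhar1983
[support] (card P3, geometric-optics skeleton of the torque filter) a null geodesic of sub-extremal
Kerr (M, a) with constants (E > 0, L_z, Q ≥ 0) and |L_z| ≥ 7ME has a radial turning point or
forbidden radius outside the horizon: ∃ r > r₊ with R(r) = (E(r²+a²) − aL)² − Δ((L − aE)² + Q) ≤ 0,
Δ = r² − 2Mr + a² written out (cone repair 2026-08-15: previously `Kerr.delta` of Sweep2.lean; the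
new text is the old one by `Iff.rfl`), so it cannot come in from infinity and cross 𝓗⁺ (the critical
impact parameters satisfy sup |b_c| = 7M, approached only at extremality, retrograde, r = 4M).
[difficulty: provable-now] -/
@[route_item "route-FinalStateConjecture-RecedingSphereBudgets"]
def NullCaptureCone : Prop :=
  open Literature.Geometry.Lorentzian in ∀ (M a E L Q : ℝ), 0 < M → |a| < M → 0 < E → 0 ≤ Q → 7 * M * E ≤ |L| → ∃ r : ℝ, Kerr.rPlus M a < r ∧ (E * (r ^ 2 + a ^ 2) - a * L) ^ 2 - (r ^ 2 - 2 * M * r + a ^ 2) * ((L - a * E) ^ 2 + Q) ≤ 0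

/-- item stmt-FinalStateConjecture-14742 · support · rank 9 · closed · proved by Summit.FinalStateConjecture.FinalStateConjecture.Theorems.almostMonotoneLimit_proof @ 3c3867751c78 (prover) · by planner
sources: doi:10.1007/s00220-002-0723-2
[support] (card P1) a real function bounded below on [T, ∞) with E(t₂) ≤ E(t₁) + F(t₁) for T ≤ t₁ ≤
t₂ and F → 0 has a limit at +∞ (limsup ≤ liminf; ten lines). [difficulty: provable-now] -/
@[route_item "route-FinalStateConjecture-RecedingSphereBudgets"]
def AlmostMonotoneLimit : Prop :=
  ∀ (E F : ℝ → ℝ) (T b : ℝ), (∀ t, T ≤ t → b ≤ E t) → (∀ t₁ t₂, T ≤ t₁ → t₁ ≤ t₂ → E t₂ ≤ E t₁ + F t₁) → Tendsto F atTop (𝓝 0) → ∃ l : ℝ, Tendsto E atTop (𝓝 l)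

/-- item stmt-FinalStateConjecture-14743 · assembly · rank 1 · closed · proved by Summit.FinalStateConjecture.FinalStateConjecture.Theorems.RecedingSphereBudgets.assembly_proof @ b13a0b073f36 (prover) · by planner
sources: arXiv:1710.01722, Christodoulou1999
[assembly] ShapeSettledFinalEra → MassFreezing → SpinFreezing → Reanchoring → FinalStateConjecture. -/
@[route_item "route-FinalStateConjecture-RecedingSphereBudgets"]
def Assembly : Prop :=
  ShapeSettledFinalEra → MassFreezing → SpinFreezing → Reanchoring → FinalStateConjecture

/-! D-0027 §2.1 — DECIDING THEOREM (planner-authored via `route open/edit --closes-file`; by planner-rbadge-FinalStateConjecture-RecedingSp-aeb872ba-g2-0 2026-08-16T23:47:24Z):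
its hypotheses are this route's items and its conclusion the sub-problem Statement (glue_lint), and it elaborates with this file. -/

@[closes "route-FinalStateConjecture-RecedingSphereBudgets"] theorem closes (hH : ShapeSettledFinalEra) (hM : MassFreezing) (hS : SpinFreezing) (hR : Reanchoring) : FinalStateConjecture := by
  intro X _ _ _ _ _ _
  -- (1) tame Christodoulou genericity (codimension 1) is monotone under pointwise implication on
  --     the admissible class: the end `e` and the tame immersed family `F` serve verbatim.
  have mono : ∀ {𝓓 : Set (Literature.Geometry.Lorentzian.InitialDataSet (𝓡 3) X)}
      {P P' : Literature.Geometry.Lorentzian.InitialDataSet (𝓡 3) X → Prop},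
      (∀ D ∈ 𝓓, P D → P' D) →
        Literature.Geometry.Lorentzian.InitialDataSet.IsTameChristodoulouGeneric 𝓓 P 1 →
          Literature.Geometry.Lorentzian.InitialDataSet.IsTameChristodoulouGeneric 𝓓 P' 1 := by
    intro 𝓓 P P' hPP' h d hd
    obtain ⟨e, F, hF, himm, h0, hinj, hD, hgood⟩ := h d ⟨hd.1, fun hP ↦ hd.2 (hPP' d hd.1 hP)⟩
    exact ⟨e, F, hF, himm, h0, hinj, hD,
      fun c hc hmem ↦ hgood c hc ⟨hmem.1, fun hP ↦ hmem.2 (hPP' (F c) hmem.1 hP)⟩⟩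
  refine mono ?_ (hH X)
  -- (2) pointwise: for an admissible datum, H's conclusion (MGHD exists; every MGHD has complete
  --     𝓘⁺ and a shape-settled final era with drifting labels Q′) gives the Statement's
  --     conclusion: M and S freeze the labels, R re-anchors Q′ to the settling clause.
  rintro D hD ⟨hex, hall⟩
  refine ⟨hex, fun 𝒟 h𝒟 ↦ ⟨(hall 𝒟 h𝒟).1, ?_⟩⟩
  obtain ⟨N, m₀, χ, τ₀, δ₀, M, a, motion, U, Ψ, ρ, U₀, Ψ₀, O, hQ⟩ := (hall 𝒟 h𝒟).2
  exact hR X D hD 𝒟 h𝒟 (hall 𝒟 h𝒟).1 N m₀ χ τ₀ δ₀ M a motion U Ψ ρ U₀ Ψ₀ O hQ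
    (hM X D hD 𝒟 h𝒟 (hall 𝒟 h𝒟).1 N m₀ χ τ₀ δ₀ M a motion U Ψ ρ U₀ Ψ₀ O hQ)
    (hS X D hD 𝒟 h𝒟 (hall 𝒟 h𝒟).1 N m₀ χ τ₀ δ₀ M a motion U Ψ ρ U₀ Ψ₀ O hQ)

end Summit.FinalStateConjecture.FinalStateConjecture.Theses.RecedingSphereBudgets
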